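import Summits.NavierStokesRegularity.NavierStokesRegularity.Theses.SelfMixingDichotomy
import Summits.NavierStokesRegularity.NavierStokesRegularity.Theorems.SelfMixingDichotomyCoherentScaleExclusionFloors
import Literature.Analysis.FluidPDE.PassiveScalarEnergyDecay
import Summits.NavierStokesRegularity.NavierStokesRegularity.Theorems.SelfMixingDichotomyCoherentScaleExclusionTypeIKinWitness
import Summits.NavierStokesRegularity.NavierStokesRegularity.Theorems.SelfMixingDichotomyCoherentScaleExclusionRobustSwirlCoherence
import Summits.NavierStokesRegularity.NavierStokesRegularity.Theorems.SelfMixingDichotomyCoherentScaleExclusionRobustSwirlCoherenceLocal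
import Summits.NavierStokesRegularity.NavierStokesRegularity.Theorems.SelfMixingDichotomyCoherentScaleExclusionSwirlCoherenceCentre
import Summits.NavierStokesRegularity.NavierStokesRegularity.Theorems.SelfMixingDichotomyCoherentScaleExclusionMixIsometry
import Summits.NavierStokesRegularity.NavierStokesRegularity.Theorems.SelfMixingDichotomyCoherentScaleExclusionMixGalilean
import Summits.NavierStokesRegularity.NavierStokesRegularity.Theorems.SelfMixingDichotomyCoherentScaleExclusionHeatGaussianTail
import Summits.NavierStokesRegularity.NavierStokesRegularity.Theorems.SelfMixingDichotomyCoherentScaleExclusionDeltaTail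
import Summits.NavierStokesRegularity.NavierStokesRegularity.Theorems.SelfMixingDichotomyCoherentScaleExclusionNoTypeII
import HarnessLib.Audit

/-!
# Birth skeleton (BC3) of the crux `SelfMixingDichotomy.CoherentScaleExclusion`

(crux item `stmt-NavierStokesRegularity-1423`, rank 3, route `route-NavierStokesRegularity-SelfMixingDichotomy`;
tree path `Cruxes/CoherentScaleExclusion/Lines/birth.lean`; registrar `planner-skel-stmt-NavierStokesRegularity-1423-0`,
2026-08-17. The route predates the Lean birth certificate; this file supplies BC3 retroactively. No `Disproof.lean`
and no other crux workfile existed at registration time.)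

LEAD RESHAPE r1 (prover-line-stmt-NavierStokesRegularity-1423-0, cycle 1, 2026-08-17). (i) The regime `δ ≥ 1` of the
crux and of all three stubs is EMPTY and is now closed inside `CoherentScaleExclusion_of` by the tree theorem
`Literature.Analysis.FluidPDE.IsClassicalNSSolutionOn.dissipatesAtScale_of_isLerayHopfOn` (`PassiveScalarEnergyDecay`,
landed this cycle together with `DecayingScalarIntegrationByParts`: `L²` energy inequality for passive scalars in a
`C¹` divergence-free `L²` drift, no decay of the drift) — the three stubs carry the extra hypothesis `δ < 1` and are
otherwise verbatim the birth stubs. (ii) Landed `--supports` this cycle (Theorems/SelfMixingDichotomyCoherentScaleExclusion*):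
`…Structure` (closed twin `coherentScaleExclusion_of_regimes`, S1-dominations of A and I, `S2 ↔ nonexistence`,
route note `coherentScaleExclusion_of_sequentialTypeIExclusion_of_cascade` = S1 ∧ SigB ⇒ crux), `…TypeIRegime`
(`¬ TypeISingularityExists ⇒ SigA` through `isTypeISingularPoint_of_loadCeiling_of_not_bdd`), `…WindowRegime`
(final-time one-scale ε-regularity `coherentWindowRegime_bdd_of_oneScale`, sub-case `coherentWindowRegime_small`).
(iii) What is open is exactly regime (B) for `0 < δ < 1` (and A, I only insofar as S1 / `¬TypeISingularityExists` are).

LEAD RESHAPE r2 (prover-line-stmt-NavierStokesRegularity-1423-c1-0, continuation lead, cycle 1, 2026-08-17). The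
empty regime is larger than `δ ≥ 1`: there is a DRIFT-INDEPENDENT ceiling `δ₀ < 1` above which every `C¹`
divergence-free `L²` drift `δ`-mixes every blob at every scale (Nash 1958: the `L¹ → L²` smoothing of
`∂ₜ − Δ + u·∇` is uniform in divergence-free `u`; here: Kato's `L¹` contraction + the Nash inequality obtained from
the tree's whole-space Gagliardo–Nirenberg–Sobolev inequality `Literature.Analysis.FluidPDE.eLpNorm_six_le_eLpNorm_fderiv_two`
+ the energy identity of `PassiveScalarEnergyDecay`). Three new registered stubs carry it — K
`stub_passiveScalarL1Antitone` (the `L¹` norm of a passive scalar is nonincreasing), N `stub_nashInequality`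
(`(∫ f²)⁵ ≤ C (∫ |f|)⁴ (∫ ‖Df‖²)³` on `ℝ³`), C `stub_nashCeilingAssembly` (K-sig → N-sig → the ceiling for `C¹`
divergence-free `L²` drifts) — glued in `nashCeiling` (standing Navier–Stokes velocities) and used by
`CoherentScaleExclusion_of`: the range `[δ₀, ∞)` of the crux is closed in the skeleton, the regime stubs A/I/B
(unchanged, stated for `δ < 1`) are invoked only for `0 < δ < δ₀ < 1`. The sibling line on `MixingPayoff` has
meanwhile landed the window well-posedness `scalarSlabWellposed` and the Type-I floor `typeIFloor`
(Theorems/SelfMixingDichotomyMixingPayoff*), which make `¬ MIX` provable; the lead's `--supports` helpers built on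
them (Type-I floor corollary, load floor `cknC (A r) ≤ M₁ ⇒ ¬MIX(r, δ(M₁))`) are recorded in the lead's NOTES.
STATUS after wave 1 of lead c1 (2026-08-17): K, N, C LANDED (p155321, p155883, p156384) and are imported below (no
`sorry` left in them); the registered helpers `stub_loadFloor` (p157351, + tools p156911) and `stub_typeICoherence`
(p155884) landed too, with the lead's glue `Theorems/SelfMixingDichotomyCoherentScaleExclusionFloors` (p157605:
`coherentScaleExclusion_nashCeiling`, `coherentScaleExclusion_of_nashCeiling_le` = THE CRUX FOR δ ≥ δ₀ OUTRIGHT,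
`coherentScaleExclusion_loadFloor`, `coherentScaleExclusion_notMix_recur_of_load_recur`) and
`…NonMixingExclusion` (`sequentialTypeIExclusion_and_coherentScaleExclusion_iff` : S1 ∧ S2 ⇔ "∀ δ > 0, recurrently
non-δ-mixing final-time points are bounded" — the load parameter drops out; `coherentScaleExclusion_bdd_of_typeI`,
`bdd_of_typeI_of_sequentialTypeIExclusion_of_coherentScaleExclusion` — S1 ∧ S2 bar all L∞-Type-I blow-up),
`Theorems/SelfMixingDichotomyThesisReduction` (p158429: Thesis ⇔ H ∧ NME) and `Theorems/SelfMixingDichotomyPayoffCollapse`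
(p158580/p158797: MixingPayoff ⇔ "∃ δ > 0, no (singular) point is cofinally δ-mixing"; S1 ∧ S2 ⇔ "every singular point is
cofinally δ-mixing for every δ > 0" — the route in two load-free lines). The only `sorry`s left are the three regime
stubs A, I, B (open mathematics; A and I dominated by S1, B crux-sized).

LEAD c2 (prover-line-stmt-NavierStokesRegularity-1423-c2-0, continuation lead, 2026-08-17). No reshape of the cut (it is
LOSSLESS: `coherentScaleExclusion_iff_regimes : S2 ↔ (A) ∧ (I) ∧ (B)`, p164250 — every line for S2 must prove B). Landed
`--supports` this cycle: (1) `Theorems/SelfMixingDichotomyCoherentScaleExclusionUnboundedLoad` (p164250): the unbounded-load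
form `S2_unb` ("no point with `limsup C = ∞` and recurrent `M`-loaded non-`δ`-mixing scales"), `S2 → S2_unb ↔ (I) ∧ (B)`,
`S2_unb ∧ S1_sup → S2` (registered sub-goal `coherentScaleExclusion_of_unboundedLoadExclusion_of_supForm`), and at route
level `P_quant → S2_unb → ¬TypeISingularityExists → NavierStokesRegularity` — in the S1 lead's restated thesis
`P_quant ∧ S2 ∧ S1_sup` regime (A) of S2 is carried by `S1_sup`, so the structure crux can be filed as `S2_unb`. (2) THE
KINEMATIC WITNESS (`Theorems/SelfMixingDichotomyCoherentScaleExclusionKinWitness*`, eight files: p164760 p164816 p164853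
p164909 p164919 p164956 p165014 + assembly): an explicit smooth divergence-free finite-energy drift with an `L∞` Type-I(2)
swirling core of radius `2(1−t)^{3/8}` (`uW t x = (1−t)^{−7/8} expNegInvGlue(4 − ‖x‖²/(1−t)^{3/4}) • (−x₁, x₀, 0)`) has
`C(r) ≥ κ r^{−1/3} → ∞` at its tip AND is non-`δ`-mixing at EVERY small scale (drift-generic Type-I floor
`kinWitness_typeICoherence_of_windowBounds`); hence `stub_coherentCascadeExclusion_false_without_momentum`: stub B with the
Navier–Stokes class replaced by the kinematic class (smooth on `[0,T) × ℝ³`, div-free, bounded energy, Type-I(2)) is FALSE —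
B is irreducibly dynamical (any proof must use the momentum equation), and it cannot be refuted without a finite-energy
blow-up. Stubs after c2: closed K, N, C (+ the c2 sub-goals); open A, I (stub-blocked on the named open statements
`¬TypeISingularityExists` / S1 = NSI ∧ S1_sup, dominations p150484, p146791, p161201), B (open mathematics, promote).

LEAD c3 (prover-line-stmt-NavierStokesRegularity-1423-c3-0, continuation lead, 2026-08-17). No reshape of the cut. Ten
registered sub-goals, ALL LANDED `--supports` (imported below, no `sorry` in them): (1) AMPLITUDE-FREE COHERENCE —
`stub_sphereTangential_notDissipatesAtScale` (Theorems/…SwirlCoherence, p168233; pieces `stub_radialBump` p167582,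
`stub_inner_gradient_eq_zero_of_reflectionInvariant` p167715, `stub_heatSolution_comp_linearIsometryEquiv` p167721,
`stub_heatSolution_unique` p167835, `stub_heatBumpFloor_allScales` p167796): a drift TANGENTIAL TO THE SPHERES about the
centre on the window (`⟪u(t,x), x⟫ = 0`: every pure swirl `a(t,x) • (−x₁, x₀, 0)`, every differential rotation /
spherical-shell flow, of any amplitude and time dependence, no regularity assumed) is non-`δ`-mixing at EVERY scale
`r > 0` for every `0 ≤ δ ≤ δ₁` (`δ₁ > 0` universal: a third of the pure-heat bump floor) — radial blobs are exact first
integrals of `u·∇` (the CKRZ mechanism), formally: the heat evolution of a radial bump is radial by isometry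
invariance + uniqueness, so its transport term vanishes. (2) REGIME A IS NOT KINEMATIC —
`stub_coherentTypeIExclusion_false_without_momentum` (Theorems/…TypeIKinWitness, with `coherentTypeI_kinematicWitness`;
pieces `stub_selfSimilarSwirl_pointwise` p167925, `…_loadFloor` p167911, `…_loadCeiling` p168103): for ONE `δ` and EVERY
threshold `M` the exactly self-similar swirling eddy `(A(1−t)⁻¹ expNegInvGlue(4 − ‖x‖²/(1−t))) • (−x₁,x₀,0)`,
`A = max 1 (M/κ)`, is smooth, div-free, finite-energy, `L∞` Type-I(2A), has `κA³ ≤ C(r) ≤ M₁` at every scale (a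
Type-I CEILING and `M`-loaded), is `δ₁`-coherent at every scale by (1), and is unbounded at `(1,0)`: stub A with the
Navier–Stokes class replaced by the kinematic class (even with an `L∞` Type-I bound) is FALSE. With c2's p165625 (B)
this certifies that the two substantive regimes of the lossless cut need the momentum equation; the quantifier order
`∀δ ∃M ∀u` is what the drift-generic Type-I floor of c2 (`δ₁(K) → 0`) could not serve and (1) does. Stubs after c3:
open A, I (stub-blocked on S1 / `¬TypeISingularityExists`), B (crux-sized, promote); everything else closed.
WAVE 2 of lead c3 (invariances and ROBUSTNESS of the MIX functional; all LANDED and imported below): INV1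
`stub_dissipatesAtScale_translate` (p168837), INV2 `stub_dissipatesAtScale_isometry` (p168787), INV3
`stub_dissipatesAtScale_galilean` (p169429) — translation / isometry / Galilean-boost invariance of `DissipatesAtScale` (the
route text's "Galilean/rotation invariant", now theorems); MAXP `stub_mixClass_abs_le_of_datum` (p168856); STAB
`stub_mixClass_driftStability` (p169245 + p169336: whole-space MIX-class form of Johansson–Sorella 2024 L.2.2,
`∫(θ₁−θ₂)(t)² ≤ M² V (t−a)`); TAIL `stub_heatBlob_gaussian_upper` (p169434); lead glue
`stub_sphereTangential_notDissipatesAtScale_centre` (p168954: SW0 about any centre) and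
`stub_notDissipatesAtScale_of_near_sphereTangential` (p169578: ROBUST — drifts `L²`-close at the scale-invariant rate `c₀ r`
to a sphere-tangential drift are `δ₂`-coherent; non-mixing is OPEN around the toroidal class); helper
`coherentScaleExclusion_iff_tail` (p169067: the crux is antitone in `δ` and equivalent to its own `δ → 0⁺` tail). Wave 2c: STAB-loc
`stub_mixClass_driftStability_local` (p169651 + p169896: cross term split over a set `D` and `Dᶜ`) and the FINITE-ENERGY
form ROBUST-loc `stub_notDissipatesAtScale_of_locallyNear_sphereTangential` (p170040: closeness only on `B(0, R r)`, an
arbitrary `L²` bound `E` outside, `e^{1/2 − R²/3} E ≤ c₀ r`, i.e. `R ≍ √log(E/r)`; the Gaussian tail of the heat blob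
absorbs the far field) — the version applicable to Navier–Stokes velocities. After lead c3 the only `sorry`s are again
the three regime stubs A, I, B.

THE CRUX (S2). For every `δ > 0` there is `M` such that for every finite-energy classical solution `u` of NS
(`ν = 1`) on `ℝ³ × [0,T)` from a rapidly decaying datum and every `x₀`: if coherent loaded scales RECUR at `(T,x₀)`
— along some `r_k → 0` both `ofReal M ≤ C(r_k)` (`C = cknC`, the scaled `L³` load on `Q_{r_k}(T,x₀)`) and
`¬ MIX(u,T,x₀,r_k,δ)` (the drift fails to `δ`-dissipate some passive scalar blob at scale `r_k`) — then `u` is bounded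
near `(T,x₀)` (BDD). The refuter's structure note (item notes, 2026-08-15) applies: BDD with `M > 0` contradicts the
antecedent, so S2 is a nonexistence claim, antitone in `M`, vacuous for `δ ≥ 1`.

THE CUT — regime decomposition of the load profile `r ↦ C(r)` at the point. At a point where coherent loaded scales
recur, exactly one of three things happens to `C(r)` as `r → 0⁺`, and each regime is owned by a different technique:

* `stub_coherentTypeIExclusion` [L/XL, OPEN; regime (A) `limsup C < ∞`, a Type-I CEILING at the point]: for every
  `δ > 0` there is `M` such that a ceiling `C(r) ≤ M₁ (0 < r < r₁)` together with recurrent `δ`-coherent `M`-loaded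
  scales forces BDD. This is the Koch–Nadirashvili–Seregin–Šverák exclusion of axisymmetric Type-I blow-up with the
  exact symmetry replaced by recurrent approximate first integrals of the drift (CKRZ: not relaxation-enhancing ⇔
  `u·∇` has `H¹` eigenfunctions). Tools exist: under the ceiling the parabolic zooms `r_k u(T + r_k² s, x₀ + r_k y)`
  are precompact in `L³_loc` (Seregin: `sup C < ∞ ⇒ sup (A + D + E) < ∞`, in tree as
  `Seregin2020.scaledEnergies_bounded_of_cknC_le_unif`), `MIX` and `C` are scale invariant, so the limit is a Type-I
  local-energy ancient flow, singular at the origin, `M`-loaded and non-`δ`-mixing at unit scale; what is missing is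
  the Liouville theorem for such COHERENT profiles. Dominated twice, by name: by the sibling crux
  `SequentialTypeIExclusion` (S1) of this route (`typeIBranch_of_sequentialTypeIExclusion`, proved in the closed
  twin) and, via a Leray continuation past `T`, by `¬ Literature.Analysis.FluidPDE.TypeISingularityExists` ⇐ the KNSS Liouville
  conjecture (L) (in-tree chain `LiouvilleConjectureNS.not_nontrivialTypeIAncientExists_measurable`). Why it might
  fail: only together with Type-I blow-up itself — a discretely self-similar Type-I singularity repeats ONE eddy at
  the scales `λ^k`, hence is either cofinitely mixing or recurrently coherent; the coherent alternative is exactly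
  this stub.
* `stub_coherentWindowExclusion` [L, OPEN; regime (I) `liminf C < ∞ = limsup C`, Type-I WINDOWS inside a cascade]:
  for every `δ > 0` there is `M` such that no point carries, simultaneously, recurrent bounded-load scales, unbounded
  load, and recurrent `δ`-coherent `M`-loaded scales. Owned by the scale-intermittent Type-II technology of S1
  (Seregin, lecture notes, Prop. 1.5 pattern: small `liminf` + one-scale `ε`-regularity `WangWuZhou2019` /
  `ckn_epsilon_regularity_holds`); dominated by S1 modulo the elementary bound BDD ⇒ `cknC r ≤ K³|B_ρ|`
  (`windowBranch_of_sequentialTypeIExclusion`, proved in the closed twin).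
  Why it might fail: a scale-intermittent Type-II blow-up with coherent loaded bursts between Type-I windows.
* `stub_coherentCascadeExclusion` [XL, OPEN; regime (B) `C(r) → ∞`, a PURE CASCADE; the irreducible core]: for every
  `δ > 0`, at a point where the load diverges along ALL small scales, `δ`-coherent scales cannot recur (the threshold
  `M` drops out: every small scale is `M`-loaded). This is the content of S2 that no other item of the route touches
  (given S1 and `MixingPayoff`, the deciding theorem `closes` only ever invokes S2 at such points): a self-sustained
  cascade must keep converting order into disorder at every scale it loads; a scale whose drift admits an
  approximate first integral passes no energy down. Why it might fail: a Type-II blow-up with a coherent swirling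
  core (the morphology of Hou's axisymmetric scenario, arXiv:2107.06509, if it is Type II in `C`); as `δ → 0` the
  stub tends to "no pure-cascade blow-up at all".

`CoherentScaleExclusion_of : CoherentScaleExclusion` (the ONLY theorem of this file concluding the crux; A12 layer
invariant: conclusion = the crux BY NAME, no `Prop` hypotheses, placeholders only inside the three declared stubs,
which it uses by name) is the real composition (≈ 45 lines): take `M := max M_A M_I`; antitonicity of recurrence in
the threshold (`ENNReal.ofReal_le_ofReal`); trichotomy `C → ∞` / ceiling / windows-and-unbounded by two applications
of excluded middle with the `push Not` conversions `¬(C → ∞) ⇒ liminf C < ∞` and `¬ceiling ⇒ load unbounded`;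
regime (B) and (I) stubs conclude `False`, regime (A) concludes BDD. Its CLOSED twin
`CoherentScaleExclusion_of_hyps : <sig A> → <sig I> → <sig B> → CoherentScaleExclusion` (same proof, the stub
statements as hypotheses, no placeholder anywhere) is the registrar's evidence file
`bc/CoherentScaleExclusion_birth_closed.lean` (attached to the crux item), which also proves the domination
remarks: S1 (`SequentialTypeIExclusion`, the sibling crux the deciding theorem consumes anyway) implies the statements
of stub A and stub I, hence the route note `SequentialTypeIExclusion → <sig B> → CoherentScaleExclusion` — MODULO S1
THE CRUX IS THE CASCADE STUB. The stubs A and I stay genuine targets: each is strictly weaker than S1 (it carries the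
coherence hypothesis) and has an attack S1 lacks (rigidity of coherent profiles).

BC3 PROBES (registrar folder `bc/probe_{A,I,B}.lean` = combined battery, `bc/probeT_{A,I,B}.lean` = one theorem per
tactic; route file imported; `set_option maxHeartbeats 400000` per theorem; farm `lean check`, 2026-08-17): for each
stub `S ∈ {A, I, B}` and each target `CoherentScaleExclusion`, `NavierStokesRegularity`, `¬NavierStokesRegularity`, the
battery `first | exact? | simpa using h | simpa [target] using h | aesop | (unfold target; aesop)` FAILS (9/9
combined: heartbeat timeout / `simp` nested timeout / unsolved goals) and every single tactic FAILS on its own (45/45: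
`exact?` "could not close the goal" ×9, `simpa` "Type mismatch after simplification" ×18, `aesop` "failed to prove
the goal after exhaustive search" / unsolved goals ×15, `unfold; aesop` timeout on the crux target ×3). No stub is
cheaply the crux or the summit: each excludes ONE regime of the load profile and the crux needs all three.

REJECTED CUTS (registrar's notes): (i) profile level "zoom ⇒ coherent ancient profile" + "Liouville for coherent
profiles": `MIX` is a pointwise PDE constraint on passive scalars and is ill-typed for the merely `L³_loc` limits of
the ceiling regime, while the `L∞`-normalised KNSS zoom cannot be centred at `x₀` (near-maxima may sit `≫ r_k` away);
(ii) the one-scale strengthening "`M`-loaded and non-`δ`-mixing at ONE small scale ⇒ BDD" is refutable in kind by a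
thin intense axisymmetric vortex ring without swirl (globally smooth, coherent core, arbitrarily loaded at the core
scale; Gallay–Šverák), so recurrence down to `r → 0` is essential and the cut must go through blow-up regimes.

LEAD c5 (prover-line-stmt-NavierStokesRegularity-1423-c5-0, continuation lead = sixth lead, 2026-08-17). RESHAPE r3: the
cut A/I/B is kept (lossless), and ONE bridge stub is added and registered, `stub_cknC_ceiling_of_isTypeIBlowup`
(W2): for a standing solution, the `L∞` Type-I RATE `‖u(t,x)‖ ≤ C/√(T−t)` near `T` (`IsTypeIBlowup u T`) forces a
CENTRED CUBIC CEILING `cknC r (T,x₀) u ≤ M₁`, `0 < r < r₁`, at EVERY `x₀` — given, as a hypothesis, the Literature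
statement "Type-I rate ⇒ bounded scaled energies at the vertex" (Seregin 2014 Lecture Notes, Prop. 3.11 (i), case
`G₂`; = Seregin ICM 2010 Prop. 1.3 (i); proof = Seregin–Šverák 2009 Lemma 3.5 with the absorption (as11) taken in its
elementary time-window form for the WHOLE velocity, no axial symmetry), which this lead PROVES in the tree
(`Literature.Analysis.FluidPDE.scaledEnergies_bounded_of_typeIRate`, files `TypeIRateCubicAbsorption`,
`ScaledEnergyBoundOfCubicAbsorption`, `TypeIRateScaledEnergyBound`). Consequences (Theorems/…NoTypeII): regimes I and
B — in particular THE CORE STUB B — are DOMINATED by the Type-II exclusion target `TypeIIInviscidRelaxation.NoTypeII`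
(stmt-NavierStokesRegularity-0056) with coherence unused (a point with `limsup_r C = ∞` is not an `L∞`-Type-I point,
so under NoTypeII the solution extends past `T` and is bounded there); `S2 ⇐ NoTypeII ∧ S1` and
`S2 ⇐ NoTypeII ∧ ¬TypeISingularityExists`; `S1 ⇒` no `L∞`-Type-I blow-up of standing solutions (sharpening c1's
`S1 ∧ S2 ⇒` same); and `S1 ∧ NoTypeII ⇒ NavierStokesRegularity` (the pair (P, S2) of this route is, modulo S1, a
weakening of Type-II exclusion). LANDED by c5: W2 p173634 (Theorems/…TypeIRateCeiling), Literature p173802 (TypeIRateCubicAbsorption), p173799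
(ScaledEnergyBoundOfCubicAbsorption), p173903 (TypeIRateScaledEnergyBound = Prop. 3.11 (i) proved), compositions p173973
(Theorems/…NoTypeII: `coherentCascadeRegime_of_noTypeII`, `coherentWindowRegime_of_noTypeII`, `cknC_ceiling_of_isTypeIBlowup`,
`noTypeIBlowup_of_sequentialTypeIExclusion`, `navierStokesRegularity_of_sequentialTypeIExclusion_of_noTypeII`, …). Stubs after c5:
open A, I, B — all three now stub-blocked on NAMED open items (A ⇐ stmt-1424 / ¬TISE; I ⇐ stmt-1424 or stmt-0056; B ⇐ stmt-0056);
W2 closed. Sorries = exactly A, I, B.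
-/

noncomputable section

open MeasureTheory Filter Topology
open Literature.Analysis.FluidPDE

namespace Summit.NavierStokesRegularity.NavierStokesRegularity.Cruxes.CoherentScaleExclusion.Birth

set_option linter.unusedVariables false
set_option linter.dupNamespace false

/-- **stub A — `stub_coherentTypeIExclusion` (regime `limsup_{r→0} C(r) < ∞`: coherent Type-I exclusion; OPEN,
L/XL; reshaped by the lead to the contentful range `0 < δ < 1` — for `δ ≥ 1` it holds vacuously, see
`CoherentScaleExclusion_of`; dominated in tree by S1 (`coherentTypeIRegime_of_sequentialTypeIExclusion`) and by
`¬ TypeISingularityExists` (`coherentTypeIRegime_of_not_typeISingularityExists`)).** For every `δ ∈ (0,1)` there is `M` such that, for every finite-energy classical solution (`ν = 1`, rapidly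
decaying datum) and every `x₀`: a Type-I ceiling `cknC r (T,x₀) u ≤ M₁` for `0 < r < r₁` together with recurrent
`δ`-coherent `M`-loaded scales at `(T,x₀)` forces boundedness of `u` near `(T,x₀)`. KNSS2009 Thms 5.2–5.3 /
SereginSverak2009 with axisymmetry replaced by recurrent non-mixing; dominated by S1 and by (L). -/
theorem stub_coherentTypeIExclusion :
    ∀ δ : ℝ, 0 < δ → δ < 1 → ∃ M : ℝ, ∀ T : ℝ, 0 < T →
      ∀ (u : ℝ → EuclideanSpace ℝ (Fin 3) → EuclideanSpace ℝ (Fin 3)) (p : ℝ → EuclideanSpace ℝ (Fin 3) → ℝ),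
      Literature.Analysis.FluidPDE.IsClassicalNSSolutionOn (Set.Ico 0 T) 1 0 u p →
      Literature.Analysis.FluidPDE.IsLerayHopfOn T 1 0 (u 0) u →
      Literature.Analysis.FluidPDE.HasRapidSpatialDecay (u 0) →
      ∀ x₀ : EuclideanSpace ℝ (Fin 3),
      (∃ M₁ r₁ : ℝ, 0 < r₁ ∧ ∀ r ∈ Set.Ioo 0 r₁,
          Literature.Analysis.FluidPDE.cknC r ((T, x₀) : ℝ × EuclideanSpace ℝ (Fin 3)) u ≤ ENNReal.ofReal M₁) →
      (∀ r₀ : ℝ, 0 < r₀ → ∃ r ∈ Set.Ioo 0 r₀,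
          ENNReal.ofReal M ≤ Literature.Analysis.FluidPDE.cknC r ((T, x₀) : ℝ × EuclideanSpace ℝ (Fin 3)) u ∧
          ¬ (∀ θ : ℝ → EuclideanSpace ℝ (Fin 3) → ℝ,
              Literature.Analysis.FluidPDE.IsSmoothSpaceTimeOn (Set.Icc (T - r ^ 2) (T - r ^ 2 / 2)) θ →
              Literature.Analysis.FluidPDE.HasUniformRapidDecayOn (Set.Icc (T - r ^ 2) (T - r ^ 2 / 2)) θ →
              (∀ t ∈ (Set.Icc (T - r ^ 2) (T - r ^ 2 / 2)), ∀ x : EuclideanSpace ℝ (Fin 3),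
                Literature.Analysis.FluidPDE.timeDerivWithin (Set.Icc (T - r ^ 2) (T - r ^ 2 / 2)) θ t x +
                  inner ℝ (u t x) (gradient (θ t) x) = Laplacian.laplacian (θ t) x) →
              Function.support (θ (T - r ^ 2)) ⊆ Metric.ball x₀ r →
              ∫ x, (θ (T - r ^ 2 / 2) x) ^ 2 ≤ δ ^ 2 * ∫ x, (θ (T - r ^ 2) x) ^ 2)) →
      (∃ ρ : ℝ, 0 < ρ ∧ ∃ M : ℝ, ∀ t ∈ Set.Ioo (T - ρ ^ 2) T, ∀ x ∈ Metric.ball x₀ ρ, ‖u t x‖ ≤ M) := by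
  sorry

/-- **stub I — `stub_coherentWindowExclusion` (regime `liminf_{r→0} C(r) < ∞ = limsup_{r→0} C(r)`: Type-I windows
inside a cascade; OPEN, L; reshaped by the lead to `0 < δ < 1` — vacuous for `δ ≥ 1`; dominated in tree by S1
(`coherentWindowRegime_of_sequentialTypeIExclusion`); the ε-small-window-with-pressure sub-case is the tree theorem
`coherentWindowRegime_small`).** For every `δ ∈ (0,1)` there is `M` such that no finite-energy classical solution has a
final-time point carrying simultaneously (i) recurrent bounded-load scales `cknC r ≤ M'`, (ii) unbounded load
`cknC r > M''` infinitely often for every `M''`, and (iii) recurrent `δ`-coherent `M`-loaded scales. Owned by the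
scale-intermittent technology of S1 (Seregin2014Notes Prop. 1.5 pattern, one-scale ε-regularity WangWuZhou2019);
dominated by S1. -/
theorem stub_coherentWindowExclusion :
    ∀ δ : ℝ, 0 < δ → δ < 1 → ∃ M : ℝ, ∀ T : ℝ, 0 < T →
      ∀ (u : ℝ → EuclideanSpace ℝ (Fin 3) → EuclideanSpace ℝ (Fin 3)) (p : ℝ → EuclideanSpace ℝ (Fin 3) → ℝ),
      Literature.Analysis.FluidPDE.IsClassicalNSSolutionOn (Set.Ico 0 T) 1 0 u p →
      Literature.Analysis.FluidPDE.IsLerayHopfOn T 1 0 (u 0) u →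
      Literature.Analysis.FluidPDE.HasRapidSpatialDecay (u 0) →
      ∀ x₀ : EuclideanSpace ℝ (Fin 3),
      (∃ M' : ℝ, ∀ r₁ : ℝ, 0 < r₁ → ∃ r ∈ Set.Ioo 0 r₁,
          Literature.Analysis.FluidPDE.cknC r ((T, x₀) : ℝ × EuclideanSpace ℝ (Fin 3)) u ≤ ENNReal.ofReal M') →
      (∀ M'' r₁ : ℝ, 0 < r₁ → ∃ r ∈ Set.Ioo 0 r₁,
          ENNReal.ofReal M'' < Literature.Analysis.FluidPDE.cknC r ((T, x₀) : ℝ × EuclideanSpace ℝ (Fin 3)) u) →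
      (∀ r₀ : ℝ, 0 < r₀ → ∃ r ∈ Set.Ioo 0 r₀,
          ENNReal.ofReal M ≤ Literature.Analysis.FluidPDE.cknC r ((T, x₀) : ℝ × EuclideanSpace ℝ (Fin 3)) u ∧
          ¬ (∀ θ : ℝ → EuclideanSpace ℝ (Fin 3) → ℝ,
              Literature.Analysis.FluidPDE.IsSmoothSpaceTimeOn (Set.Icc (T - r ^ 2) (T - r ^ 2 / 2)) θ →
              Literature.Analysis.FluidPDE.HasUniformRapidDecayOn (Set.Icc (T - r ^ 2) (T - r ^ 2 / 2)) θ →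
              (∀ t ∈ (Set.Icc (T - r ^ 2) (T - r ^ 2 / 2)), ∀ x : EuclideanSpace ℝ (Fin 3),
                Literature.Analysis.FluidPDE.timeDerivWithin (Set.Icc (T - r ^ 2) (T - r ^ 2 / 2)) θ t x +
                  inner ℝ (u t x) (gradient (θ t) x) = Laplacian.laplacian (θ t) x) →
              Function.support (θ (T - r ^ 2)) ⊆ Metric.ball x₀ r →
              ∫ x, (θ (T - r ^ 2 / 2) x) ^ 2 ≤ δ ^ 2 * ∫ x, (θ (T - r ^ 2) x) ^ 2)) →
      False := by
  sorry

/-- **stub B — `stub_coherentCascadeExclusion` (regime `C(r) → ∞`: the pure cascade; OPEN, XL; the irreducible core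
of the crux; reshaped by the lead to `0 < δ < 1` — vacuous for `δ ≥ 1`; modulo S1 it IS the crux:
`coherentScaleExclusion_of_sequentialTypeIExclusion_of_cascade`).** For every `δ ∈ (0,1)`: no finite-energy classical solution has a final-time point at which the load
diverges along ALL small scales (`∀ M', cknC r ≥ M'` for all `0 < r < r₁(M')`) while `δ`-coherent scales recur
(`¬ MIX(r,δ)` for arbitrarily small `r`). The threshold `M` of the crux drops out here: every small scale is
loaded. -/
theorem stub_coherentCascadeExclusion :
    ∀ δ : ℝ, 0 < δ → δ < 1 → ∀ T : ℝ, 0 < T →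
      ∀ (u : ℝ → EuclideanSpace ℝ (Fin 3) → EuclideanSpace ℝ (Fin 3)) (p : ℝ → EuclideanSpace ℝ (Fin 3) → ℝ),
      Literature.Analysis.FluidPDE.IsClassicalNSSolutionOn (Set.Ico 0 T) 1 0 u p →
      Literature.Analysis.FluidPDE.IsLerayHopfOn T 1 0 (u 0) u →
      Literature.Analysis.FluidPDE.HasRapidSpatialDecay (u 0) →
      ∀ x₀ : EuclideanSpace ℝ (Fin 3),
      (∀ M' : ℝ, ∃ r₁ : ℝ, 0 < r₁ ∧ ∀ r ∈ Set.Ioo 0 r₁,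
          ENNReal.ofReal M' ≤ Literature.Analysis.FluidPDE.cknC r ((T, x₀) : ℝ × EuclideanSpace ℝ (Fin 3)) u) →
      (∀ r₀ : ℝ, 0 < r₀ → ∃ r ∈ Set.Ioo 0 r₀,
          ¬ (∀ θ : ℝ → EuclideanSpace ℝ (Fin 3) → ℝ,
              Literature.Analysis.FluidPDE.IsSmoothSpaceTimeOn (Set.Icc (T - r ^ 2) (T - r ^ 2 / 2)) θ →
              Literature.Analysis.FluidPDE.HasUniformRapidDecayOn (Set.Icc (T - r ^ 2) (T - r ^ 2 / 2)) θ →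
              (∀ t ∈ (Set.Icc (T - r ^ 2) (T - r ^ 2 / 2)), ∀ x : EuclideanSpace ℝ (Fin 3),
                Literature.Analysis.FluidPDE.timeDerivWithin (Set.Icc (T - r ^ 2) (T - r ^ 2 / 2)) θ t x +
                  inner ℝ (u t x) (gradient (θ t) x) = Laplacian.laplacian (θ t) x) →
              Function.support (θ (T - r ^ 2)) ⊆ Metric.ball x₀ r →
              ∫ x, (θ (T - r ^ 2 / 2) x) ^ 2 ≤ δ ^ 2 * ∫ x, (θ (T - r ^ 2) x) ^ 2)) →
      False := by
  sorry

/-! ## The Nash ceiling (lead reshape r2): three provable stubs and their glue -/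

/-- **stub W2 — `stub_cknC_ceiling_of_isTypeIBlowup` (lead c5 reshape r3; bridge, M; delegated).** Given the
Literature statement "Type-I rate ⇒ bounded scaled energies at the vertex" (hypothesis `hSE`, verbatim the statement of
`Literature.Analysis.FluidPDE.scaledEnergies_bounded_of_typeIRate`: for a suitable weak solution `(u, p)` of the unforced
unit-viscosity equations on an open `Q ⊇ Q_{r₀}(z)` with a weak spatial gradient `G`, `C(r₀; z), D(r₀; z) < ∞` and
`√(t_z − t) ‖u‖ ≤ c` a.e. on `Q_{r₀}(z)`, the sum `A + E + C + D` is bounded on `0 < r < r₀/2`; Seregin 2014 Prop. 3.11 (i)),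
every standing solution (`ν = 1`, classical on `[0,T)`, Leray–Hopf, rapidly decaying datum) with the `L∞` Type-I rate at `T`
(`IsTypeIBlowup u T`: `‖u(t,x)‖ ≤ C/√(T − t)` for all `x` and all `t < T` near `T`) has a centred cubic ceiling
`cknC r (T, x₀) u ≤ ofReal M₁` for `0 < r < r₁` at EVERY `x₀`. Route: the Leray continuation `(v, q)` of `u 0`
(`exists_isGlobalLerayHopf_and_isLocalEnergySolutionOn`) is suitable on the slab `(0, T+1) × ℝ³`, has `q ∈ L^{3/2}` and
`v ∈ L³` on `(0,T) × ℝ³`, and `v = u` a.e. there (weak–strong uniqueness, as in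
`isTypeISingularPoint_of_loadCeiling_of_not_bdd`); the rate transfers a.e. to `Q_{r₀}(T, x₀)`, `r₀² < T`, `r₀² ≤ T − t₁`;
`hSE` bounds `C(r; v) = C(r; u)` for `r < r₀/2`. -/
theorem stub_cknC_ceiling_of_isTypeIBlowup
    (hSE : ∀ (Q : TopologicalSpace.Opens (ℝ × EuclideanSpace ℝ (Fin 3)))
      (u : ℝ → EuclideanSpace ℝ (Fin 3) → EuclideanSpace ℝ (Fin 3)) (p : ℝ → EuclideanSpace ℝ (Fin 3) → ℝ)
      (G : ℝ → EuclideanSpace ℝ (Fin 3) → EuclideanSpace ℝ (Fin 3) →L[ℝ] EuclideanSpace ℝ (Fin 3)),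
      Literature.Analysis.FluidPDE.IsSuitableWeakSolutionOn Q 1 0 u p →
      Literature.Analysis.FluidPDE.HasWeakSpatialGradientOn Q u G →
      ∀ (z : ℝ × EuclideanSpace ℝ (Fin 3)) (r₀ : ℝ), 0 < r₀ →
      Literature.Analysis.FluidPDE.parabolicCylinder r₀ z ⊆ (Q : Set (ℝ × EuclideanSpace ℝ (Fin 3))) →
      Literature.Analysis.FluidPDE.cknC r₀ z u ≠ ⊤ →
      Literature.Analysis.FluidPDE.cknD r₀ z p ≠ ⊤ →
      (∃ c : ℝ, ∀ᵐ w ∂(MeasureTheory.volume.restrict (Literature.Analysis.FluidPDE.parabolicCylinder r₀ z)),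
        Real.sqrt (z.1 - w.1) * ‖u w.1 w.2‖ ≤ c) →
      ∃ K : NNReal, ∀ r ∈ Set.Ioo (0 : ℝ) (r₀ / 2),
        Literature.Analysis.FluidPDE.cknAEss r z u + Literature.Analysis.FluidPDE.cknE r z G +
          Literature.Analysis.FluidPDE.cknC r z u + Literature.Analysis.FluidPDE.cknD r z p ≤ K) :
    ∀ T : ℝ, 0 < T → ∀ (u : ℝ → EuclideanSpace ℝ (Fin 3) → EuclideanSpace ℝ (Fin 3))
      (p : ℝ → EuclideanSpace ℝ (Fin 3) → ℝ),
      Literature.Analysis.FluidPDE.IsClassicalNSSolutionOn (Set.Ico 0 T) 1 0 u p →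
      Literature.Analysis.FluidPDE.IsLerayHopfOn T 1 0 (u 0) u →
      Literature.Analysis.FluidPDE.HasRapidSpatialDecay (u 0) →
      Literature.Analysis.FluidPDE.IsTypeIBlowup u T →
      ∀ x₀ : EuclideanSpace ℝ (Fin 3), ∃ M₁ r₁ : ℝ, 0 < r₁ ∧ ∀ r ∈ Set.Ioo 0 r₁,
        Literature.Analysis.FluidPDE.cknC r ((T, x₀) : ℝ × EuclideanSpace ℝ (Fin 3)) u ≤ ENNReal.ofReal M₁ :=
  -- LANDED (p173634, Theorems/…TypeIRateCeiling); its hypothesis is discharged in tree by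
  -- `Literature.Analysis.FluidPDE.scaledEnergies_bounded_of_typeIRate` (p173903), see
  -- `Theorems.cknC_ceiling_of_isTypeIBlowup` (p173973, Theorems/…NoTypeII).
  Summit.NavierStokesRegularity.NavierStokesRegularity.Theorems.stub_cknC_ceiling_of_isTypeIBlowup hSE

/-- **stub K — `stub_passiveScalarL1Antitone` (LANDED p155321, Theorems/SelfMixingDichotomyCoherentScaleExclusionPassiveScalarL1Antitone{,Tools}): the `L¹` norm of a passive scalar is nonincreasing.**
Let `θ` be jointly smooth with uniform rapid decay on `[a, b] × ℝ³`, `a < b`, solving `∂ₜθ + ⟪u, ∇θ⟫ = Δθ` there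
(one-sided time derivative within `[a, b]`), where at each time of the slab the drift `u t` is `C¹`, divergence
free and square integrable (NO decay of `u`; the class of `antitoneOn_integral_sq_of_isDivFree_memLp`). Then
`t ↦ ∫ |θ(t)|` is nonincreasing on `[a, b]`. Proof (Kato): for `ε > 0` put `φ_ε(s) = √(s² + ε²) − ε` (smooth, convex,
`|φ_ε'| ≤ 1`, `0 ≤ φ_ε(s) ≤ |s|`, `φ_ε(s) → |s|`); `F_ε(t) = ∫ φ_ε(θ(t,x)) dx` is continuous on `[a,b]` and differentiable
on `(a,b)` with `F_ε' = ∫ φ_ε'(θ) ∂ₜθ` (dominated differentiation, `|φ_ε'(θ)∂ₜθ| ≤ |∂ₜθ|` decays uniformly, exactly as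
step (B2) of `antitoneOn_integral_sq_of_transport`); by the equation `F_ε' = ∫ φ_ε'(θ) Δθ − ∫ φ_ε'(θ)⟪u,∇θ⟫`, where
`∫ φ_ε'(θ) Δθ = −∫ φ_ε''(θ) ‖Dθ‖² ≤ 0` (whole-space integration by parts of the decaying `C¹` function `φ_ε'∘θ`
against `Δθ`, coordinatewise with `integral_bilinear_hasFDerivAt_right_eq_neg_left_of_integrable`, no boundary
terms) and `∫ φ_ε'(θ)⟪u, ∇θ⟫ = ∫ D(φ_ε∘θ)(u) = 0` (the cutoff argument of
`integral_mul_inner_gradient_eq_zero_of_memLp` run with `φ_ε∘θ` in place of `θ²/2`: `|φ_ε∘θ| ≤ |θ|`,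
`‖D(φ_ε∘θ)‖ ≤ ‖Dθ‖`); so `F_ε` is antitone (`antitoneOn_of_deriv_nonpos`), and `ε → 0` by dominated convergence
(`0 ≤ φ_ε(θ) ≤ |θ|`, `|θ(t,·)|` integrable). Leans on: `IsSmoothSpaceTimeOn`, `HasUniformRapidDecayOn` (+ the API of
`RapidDecayLemmas`: `norm_le_rpow`, `norm_fderiv_le_rpow`, `norm_timeDerivWithin_le_rpow`, …), `timeDerivWithin`,
`DecayingScalarIntegrationByParts` (`exists_cutoff_seq`, `integral_fderiv_apply_eq_zero_of_hasCompactSupport`),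
Mathlib `hasDerivAt_integral_of_dominated_loc_of_deriv_le`, `antitoneOn_of_deriv_nonpos`. -/
theorem stub_passiveScalarL1Antitone :
    ∀ (a b : ℝ), a < b →
      ∀ (u : ℝ → EuclideanSpace ℝ (Fin 3) → EuclideanSpace ℝ (Fin 3)) (θ : ℝ → EuclideanSpace ℝ (Fin 3) → ℝ),
      Literature.Analysis.FluidPDE.IsSmoothSpaceTimeOn (Set.Icc a b) θ →
      Literature.Analysis.FluidPDE.HasUniformRapidDecayOn (Set.Icc a b) θ →
      (∀ t ∈ Set.Icc a b, ∀ x : EuclideanSpace ℝ (Fin 3),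
        Literature.Analysis.FluidPDE.timeDerivWithin (Set.Icc a b) θ t x + inner ℝ (u t x) (gradient (θ t) x) =
          Laplacian.laplacian (θ t) x) →
      (∀ t ∈ Set.Icc a b, ContDiff ℝ 1 (u t)) →
      (∀ t ∈ Set.Icc a b, Literature.Analysis.FluidPDE.VectorCalculus.IsDivFree (u t)) →
      (∀ t ∈ Set.Icc a b, MeasureTheory.MemLp (u t) 2 MeasureTheory.volume) →
      AntitoneOn (fun t => ∫ x, |θ t x|) (Set.Icc a b) :=
  Summit.NavierStokesRegularity.NavierStokesRegularity.Theorems.stub_passiveScalarL1Antitone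

/-- **stub N — `stub_nashInequality` (LANDED p155883, Theorems/SelfMixingDichotomyCoherentScaleExclusionNashInequality): the Nash inequality on `ℝ³`.** There is `C > 0` such that for every
`C¹` function `f : ℝ³ → ℝ` with `f ∈ L¹`, `f ∈ L²` and `‖Df‖ ∈ L²`:
`(∫ f²)⁵ ≤ C · (∫ |f|)⁴ · (∫ ‖Df‖²)³` (Nash 1958; here `‖Df(x)‖` is the operator norm of the differential,
`= ‖∇f(x)‖`). Proof: Hölder with exponents `4/5 + 1/5 = 1` on `|f|² = |f|^{4/5} · (|f|⁶)^{1/5}`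
(`ENNReal.lintegral_mul_norm_pow_le`) gives `∫ f² ≤ (∫ |f|)^{4/5} (∫ |f|⁶)^{1/5}`, and the tree's whole-space
Gagliardo–Nirenberg–Sobolev inequality `Literature.Analysis.FluidPDE.eLpNorm_six_le_eLpNorm_fderiv_two`
(`‖f‖_{L⁶} ≤ K ‖Df‖_{L²}` for `C¹` `f` with `‖f‖_{L²} < ∞`, `K = SNormLESNormFDerivOfEqConst ℝ volume 2`,
`finrank_euclideanSpace_fin`) gives `∫ |f|⁶ ≤ K⁶ (∫ ‖Df‖²)³`; take `C = K⁶ + 1` (conversion `lintegral`/`eLpNorm` ↔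
Bochner integrals of the nonnegative integrands by `integral_eq_lintegral_of_nonneg_ae`,
`MeasureTheory.eLpNorm_eq_lintegral_rpow_enorm`). Leans on: Mathlib `MeasureTheory.eLpNorm`, `MemLp`,
`ENNReal.lintegral_mul_norm_pow_le`, tree `SobolevWholeSpace`. -/
theorem stub_nashInequality :
    ∃ C : ℝ, 0 < C ∧ ∀ f : EuclideanSpace ℝ (Fin 3) → ℝ, ContDiff ℝ 1 f →
      MeasureTheory.Integrable f MeasureTheory.volume →
      MeasureTheory.Integrable (fun x => (f x) ^ 2) MeasureTheory.volume →
      MeasureTheory.Integrable (fun x => ‖fderiv ℝ f x‖ ^ 2) MeasureTheory.volume →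
      (∫ x, (f x) ^ 2) ^ 5 ≤ C * (∫ x, |f x|) ^ 4 * (∫ x, ‖fderiv ℝ f x‖ ^ 2) ^ 3 :=
  Summit.NavierStokesRegularity.NavierStokesRegularity.Theorems.stub_nashInequality

/-- **stub C — `stub_nashCeilingAssembly` (LANDED p156384, Theorems/SelfMixingDichotomyCoherentScaleExclusionNashCeilingAssembly): the drift-independent mixing ceiling from K and N.**
From the statements of stubs K (`L¹` antitone) and N (Nash) as hypotheses: there is `δ₀ ∈ (0,1)` such that for
every `δ ≥ δ₀`, every drift `u` that is `C¹`, divergence free and square integrable at each time of the window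
`[T − r², T − r²/2]`, every `x₀` and every `r > 0`, `DissipatesAtScale u T x₀ r δ` (the route's `MIX(u,T,x₀,r,δ)`,
definitionally). Proof (Nash's `L¹ → L²` decay, uniform in divergence-free drifts): let `θ` be admissible with
`supp θ(T−r²) ⊆ B_r(x₀)`, `e(s) = ∫ θ(s)²`, `m(s) = ∫ |θ(s)|`, `g(s) = ∫ ‖Dθ(s)‖²`, `t₀ = T − r²`, `t₁ = T − r²/2`.
(a) `e` is continuous on the window, differentiable inside with `e' = −2g` (step (B2) of
`antitoneOn_integral_sq_of_transport` + the equation + `integral_mul_laplacian_self_eq_neg_integral_norm_fderiv_sq`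
+ `integral_mul_inner_gradient_eq_zero_of_memLp`), and antitone (`antitoneOn_integral_sq_of_isDivFree_memLp`);
(b) `m(s) ≤ m(t₀) ≤ (vol B_r)^{1/2} e(t₀)^{1/2}` (K + Cauchy–Schwarz on the support, `Measure.addHaar_ball`:
`vol B_r = vol B₁ · r³`); (c) if `e(t₁) > δ² e(t₀)` then `e(t₀) > 0` and for all `s` in the window
`e(s) ≥ e(t₁) > δ² e(t₀)`, so N gives `g(s)³ ≥ e(s)⁵ / (C m(s)⁴) > δ¹⁰ e(t₀)³ / (C (vol B₁)² r⁶) =: (κ e(t₀)/r²)³`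
with `κ³ = δ¹⁰/(C (vol B₁)²)`, hence `g(s) > κ e(t₀)/r²` and `e' < −2κ e(t₀)/r²` inside the window, so
`e(t₁) ≤ e(t₀) − κ e(t₀)` (mean value / `antitoneOn_of_deriv_nonpos` on `s ↦ e(s) + 2κ e(t₀) s / r²`), i.e.
`δ² < 1 − κ`: impossible once `δ² + κ(δ) ≥ 1`, which holds for all `δ ≥ δ₀ := √(1 − 1/(C' + 2))`,
`C' = (C (vol B₁)²)^{1/3}` (monotonicity of `δ ↦ δ² + δ^{10/3}/C'`, `(1−η)^{5/3} ≥ 1 − 2η`). Leans on: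
`Literature.Analysis.FluidPDE.DissipatesAtScale` (`dissipatesAtScale_iff`), `PassiveScalarEnergyDecay`,
`DecayingScalarIntegrationByParts`, `RapidDecayLemmas`, Mathlib `Measure.addHaar_ball`, `Real.rpow`. -/
theorem stub_nashCeilingAssembly :
    (∀ (a b : ℝ), a < b →
      ∀ (u : ℝ → EuclideanSpace ℝ (Fin 3) → EuclideanSpace ℝ (Fin 3)) (θ : ℝ → EuclideanSpace ℝ (Fin 3) → ℝ),
      Literature.Analysis.FluidPDE.IsSmoothSpaceTimeOn (Set.Icc a b) θ →
      Literature.Analysis.FluidPDE.HasUniformRapidDecayOn (Set.Icc a b) θ →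
      (∀ t ∈ Set.Icc a b, ∀ x : EuclideanSpace ℝ (Fin 3),
        Literature.Analysis.FluidPDE.timeDerivWithin (Set.Icc a b) θ t x + inner ℝ (u t x) (gradient (θ t) x) =
          Laplacian.laplacian (θ t) x) →
      (∀ t ∈ Set.Icc a b, ContDiff ℝ 1 (u t)) →
      (∀ t ∈ Set.Icc a b, Literature.Analysis.FluidPDE.VectorCalculus.IsDivFree (u t)) →
      (∀ t ∈ Set.Icc a b, MeasureTheory.MemLp (u t) 2 MeasureTheory.volume) →
      AntitoneOn (fun t => ∫ x, |θ t x|) (Set.Icc a b)) →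
    (∃ C : ℝ, 0 < C ∧ ∀ f : EuclideanSpace ℝ (Fin 3) → ℝ, ContDiff ℝ 1 f →
      MeasureTheory.Integrable f MeasureTheory.volume →
      MeasureTheory.Integrable (fun x => (f x) ^ 2) MeasureTheory.volume →
      MeasureTheory.Integrable (fun x => ‖fderiv ℝ f x‖ ^ 2) MeasureTheory.volume →
      (∫ x, (f x) ^ 2) ^ 5 ≤ C * (∫ x, |f x|) ^ 4 * (∫ x, ‖fderiv ℝ f x‖ ^ 2) ^ 3) →
    ∃ δ₀ : ℝ, 0 < δ₀ ∧ δ₀ < 1 ∧ ∀ δ : ℝ, δ₀ ≤ δ →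
      ∀ (u : ℝ → EuclideanSpace ℝ (Fin 3) → EuclideanSpace ℝ (Fin 3)) (T : ℝ) (x₀ : EuclideanSpace ℝ (Fin 3))
        (r : ℝ), 0 < r →
      (∀ t ∈ Set.Icc (T - r ^ 2) (T - r ^ 2 / 2), ContDiff ℝ 1 (u t)) →
      (∀ t ∈ Set.Icc (T - r ^ 2) (T - r ^ 2 / 2), Literature.Analysis.FluidPDE.VectorCalculus.IsDivFree (u t)) →
      (∀ t ∈ Set.Icc (T - r ^ 2) (T - r ^ 2 / 2), MeasureTheory.MemLp (u t) 2 MeasureTheory.volume) →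
      Literature.Analysis.FluidPDE.DissipatesAtScale u T x₀ r δ :=
  Summit.NavierStokesRegularity.NavierStokesRegularity.Theorems.stub_nashCeilingAssembly

/-! ## Lead c3 (2026-08-17): amplitude-free coherence of sphere-tangential drifts (SW) and the regime-A
kinematic witness (a self-similar swirling eddy). Registered sub-goals; none feeds `CoherentScaleExclusion_of`
(the cut is lossless) — they certify that stub A, like stub B, needs the momentum equation, and that the crux's
coherence hypothesis `¬ MIX(r, δ)` holds at EVERY scale, for every `δ` below a universal constant, for every drift
tangential to the spheres about the centre (pure swirl / spherical-shell flows: radial blobs are first integrals of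
`u·∇`, the CKRZ non-relaxation-enhancing mechanism), whatever its amplitude or time dependence. -/

/-- **SW1 — a radial bump datum.** For `r > 0` a `C^∞` compactly supported `θ₀ : ℝ³ → [0, 1]`, equal to `1` on
`B̄(0, r/2)`, supported in `B(0, r)`, and RADIAL (`θ₀ x` depends only on `‖x‖`), e.g.
`θ₀ x = Real.smoothTransition ((r² − ‖x‖²) · (4 / (3 r²)))`. -/
theorem stub_radialBump :
    ∀ r : ℝ, 0 < r → ∃ θ₀ : EuclideanSpace ℝ (Fin 3) → ℝ,
      ContDiff ℝ (⊤ : ℕ∞) θ₀ ∧ HasCompactSupport θ₀ ∧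
      (∀ x, 0 ≤ θ₀ x) ∧ (∀ x, θ₀ x ≤ 1) ∧
      (∀ x ∈ Metric.closedBall (0 : EuclideanSpace ℝ (Fin 3)) (r / 2), θ₀ x = 1) ∧
      Function.support θ₀ ⊆ Metric.ball (0 : EuclideanSpace ℝ (Fin 3)) r ∧
      (∀ x y : EuclideanSpace ℝ (Fin 3), ‖x‖ = ‖y‖ → θ₀ x = θ₀ y) :=
  Summit.NavierStokesRegularity.NavierStokesRegularity.Theorems.stub_radialBump

/-- **SW2 — reflection symmetry kills the tangential derivative.** If `f : ℝ³ → ℝ` is differentiable at `x`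
and invariant under the reflection in the plane `(ℝ v)ᗮ`, and `x` lies in that plane (`⟪v, x⟫ = 0`), then
`⟪v, ∇f(x)⟫ = 0`: `Df(x)[v] = Df(Rx)[Rv] = Df(x)[−v]` (`Submodule.reflection_mem_subspace_eq_self`,
`Submodule.reflection_orthogonalComplement_singleton_eq_neg`). -/
theorem stub_inner_gradient_eq_zero_of_reflectionInvariant :
    ∀ (f : EuclideanSpace ℝ (Fin 3) → ℝ) (v x : EuclideanSpace ℝ (Fin 3)),
      DifferentiableAt ℝ f x →
      (∀ y, f ((Submodule.span ℝ {v})ᗮ.reflection y) = f y) →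
      inner ℝ v x = 0 →
      inner ℝ v (gradient f x) = 0 :=
  Summit.NavierStokesRegularity.NavierStokesRegularity.Theorems.stub_inner_gradient_eq_zero_of_reflectionInvariant

/-- **SW3 — admissible heat solutions are carried to admissible heat solutions by linear isometries.** For
`a < b`, a linear isometry `R` of `ℝ³` and `θ` jointly smooth with uniform rapid decay on `[a, b] × ℝ³` solving
the heat equation `∂ₜθ = Δθ` there (one-sided time derivative within `[a, b]`), the function
`(t, x) ↦ θ t (R⁻¹ x)` is again jointly smooth with uniform rapid decay and solves the heat equation
(`IsSmoothSpaceTimeOn.comp_linearIsometryEquiv_symm`, `timeDerivWithin_comp_linearIsometryEquiv_symm`,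
`laplacian_comp_linearIsometryEquiv_symm` of `Literature/Analysis/FluidPDE/IsometryInvariance`; the decay transfer
is the scalar version of `HasUniformRapidDecayOn.conj_linearIsometryEquiv`). -/
theorem stub_heatSolution_comp_linearIsometryEquiv :
    ∀ (a b : ℝ), a < b →
      ∀ (R : EuclideanSpace ℝ (Fin 3) ≃ₗᵢ[ℝ] EuclideanSpace ℝ (Fin 3))
        (θ : ℝ → EuclideanSpace ℝ (Fin 3) → ℝ),
      IsSmoothSpaceTimeOn (Set.Icc a b) θ → HasUniformRapidDecayOn (Set.Icc a b) θ →
      (∀ t ∈ Set.Icc a b, ∀ x : EuclideanSpace ℝ (Fin 3),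
        timeDerivWithin (Set.Icc a b) θ t x = Laplacian.laplacian (θ t) x) →
      IsSmoothSpaceTimeOn (Set.Icc a b) (fun t x => θ t (R.symm x)) ∧
      HasUniformRapidDecayOn (Set.Icc a b) (fun t x => θ t (R.symm x)) ∧
      (∀ t ∈ Set.Icc a b, ∀ x : EuclideanSpace ℝ (Fin 3),
        timeDerivWithin (Set.Icc a b) (fun t x => θ t (R.symm x)) t x =
          Laplacian.laplacian (fun y => θ t (R.symm y)) x) :=
  Summit.NavierStokesRegularity.NavierStokesRegularity.Theorems.stub_heatSolution_comp_linearIsometryEquiv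

/-- **SW4 — uniqueness of admissible heat solutions.** Two jointly smooth, uniformly rapidly decaying solutions
of `∂ₜθ = Δθ` on `[a, b] × ℝ³` with the same datum at `t = a` coincide on the slab (the tree's bounded-class
parabolic uniqueness `eq_zero_of_linear_parabolic`, `…MixingPayoffAdvectionDiffusionUnique`, with `β = 0`,
`γ = 0`, applied to the difference). -/
theorem stub_heatSolution_unique :
    ∀ (a b : ℝ), a < b → ∀ (θ₁ θ₂ : ℝ → EuclideanSpace ℝ (Fin 3) → ℝ),
      IsSmoothSpaceTimeOn (Set.Icc a b) θ₁ → HasUniformRapidDecayOn (Set.Icc a b) θ₁ →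
      (∀ t ∈ Set.Icc a b, ∀ x : EuclideanSpace ℝ (Fin 3),
        timeDerivWithin (Set.Icc a b) θ₁ t x = Laplacian.laplacian (θ₁ t) x) →
      IsSmoothSpaceTimeOn (Set.Icc a b) θ₂ → HasUniformRapidDecayOn (Set.Icc a b) θ₂ →
      (∀ t ∈ Set.Icc a b, ∀ x : EuclideanSpace ℝ (Fin 3),
        timeDerivWithin (Set.Icc a b) θ₂ t x = Laplacian.laplacian (θ₂ t) x) →
      θ₁ a = θ₂ a →
      ∀ t ∈ Set.Icc a b, ∀ x : EuclideanSpace ℝ (Fin 3), θ₁ t x = θ₂ t x :=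
  Summit.NavierStokesRegularity.NavierStokesRegularity.Theorems.stub_heatSolution_unique

/-- **HF — the pure-heat bump floor at every scale.** There is a universal `c > 0` such that for every `T`,
every `r > 0`, every centre `x₀` and every jointly smooth uniformly rapidly decaying solution `θ` of the heat
equation on the window `[T − r², T − r²/2] × ℝ³` whose datum is a bump (`0 ≤ θ(T−r²) ≤ 1`, `= 1` on
`B̄(x₀, r/2)`, supported in `B(x₀, r)`), strictly more than the fraction `c²` of the `L²` mass survives:
`c² ∫ θ(T−r²)² < ∫ θ(T−r²/2)²`. Proof = the floor assembly `kinWitness_typeICoherence_floor` /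
`stub_typeIFloorAssembly` run with the ZERO drift (F1 `stub_admissibleDriftHeatClass` with `u = 0`, bound
`√2·1/r`, `U = univ`; F2 `stub_admissibleMinPrinciple`; F3 `stub_driftHeatBumpFloor` with `K = 1`; the `L²`
accounting lemmas `typeIFloor_*`), which needs neither `r² < T` nor a Type-I cylinder: ALL scales. -/
theorem stub_heatBumpFloor_allScales :
    ∃ c : ℝ, 0 < c ∧ ∀ (T r : ℝ) (x₀ : EuclideanSpace ℝ (Fin 3)), 0 < r →
      ∀ θ : ℝ → EuclideanSpace ℝ (Fin 3) → ℝ,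
      IsSmoothSpaceTimeOn (Set.Icc (T - r ^ 2) (T - r ^ 2 / 2)) θ →
      HasUniformRapidDecayOn (Set.Icc (T - r ^ 2) (T - r ^ 2 / 2)) θ →
      (∀ t ∈ Set.Icc (T - r ^ 2) (T - r ^ 2 / 2), ∀ x : EuclideanSpace ℝ (Fin 3),
        timeDerivWithin (Set.Icc (T - r ^ 2) (T - r ^ 2 / 2)) θ t x = Laplacian.laplacian (θ t) x) →
      (∀ x, 0 ≤ θ (T - r ^ 2) x) → (∀ x, θ (T - r ^ 2) x ≤ 1) →
      (∀ x ∈ Metric.closedBall x₀ (r / 2), θ (T - r ^ 2) x = 1) →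
      Function.support (θ (T - r ^ 2)) ⊆ Metric.ball x₀ r →
      c ^ 2 * ∫ x, (θ (T - r ^ 2) x) ^ 2 < ∫ x, (θ (T - r ^ 2 / 2) x) ^ 2 :=
  Summit.NavierStokesRegularity.NavierStokesRegularity.Theorems.stub_heatBumpFloor_allScales

/-- **SSW1 — pointwise facts of the self-similar swirling eddy** (regime-A kinematic witness; blow-up time
`T = 1`, centre `0`, amplitude `A ≥ 0`):
`uA t x = (A (1−t)⁻¹ expNegInvGlue (4 − ‖x‖²/(1−t))) • (−x₁, x₀, 0)` for `t < 1`, `0` after — an `L∞`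
Type-I(2A), exactly self-similar solid-body-like swirling core of radius `2√(1−t)`. SUPPORT (`‖x‖ ≥ 2√(1−t) ⇒ 0`),
TYPE-I BOUND (`√(1−t)‖uA‖ ≤ 2A`), ENERGY (`∫‖uA t‖² ≤ 32 A² |B₁| √(1−t)`, uniformly bounded for `t ≥ 0`),
and UNBOUNDEDNESS near `(1, 0)` for `A > 0` (at `‖x‖ = √(1−t)` the speed is `A e^{−1/3} (1−t)^{−1/2}`).
Cf. `kinWitness_pointwise` (same field with exponents `−7/8`, `3/4`). -/
theorem stub_selfSimilarSwirl_pointwise :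
    ∀ A : ℝ, 0 ≤ A →
      (∀ (t : ℝ) (x : EuclideanSpace ℝ (Fin 3)), t < 1 → 2 * Real.sqrt (1 - t) ≤ ‖x‖ →
        (fun (t : ℝ) (x : EuclideanSpace ℝ (Fin 3)) => if t < 1 then
          (A * (1 - t)⁻¹ * expNegInvGlue (4 - ‖x‖ ^ 2 / (1 - t))) •
            (WithLp.toLp 2 ![-(x 1), x 0, 0] : EuclideanSpace ℝ (Fin 3)) else 0) t x = 0) ∧
      (∀ (t : ℝ) (x : EuclideanSpace ℝ (Fin 3)), t < 1 →
        Real.sqrt (1 - t) * ‖(fun (t : ℝ) (x : EuclideanSpace ℝ (Fin 3)) => if t < 1 then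
          (A * (1 - t)⁻¹ * expNegInvGlue (4 - ‖x‖ ^ 2 / (1 - t))) •
            (WithLp.toLp 2 ![-(x 1), x 0, 0] : EuclideanSpace ℝ (Fin 3)) else 0) t x‖ ≤ 2 * A) ∧
      (∃ E₀ : ℝ, ∀ t : ℝ, 0 ≤ t →
        MeasureTheory.MemLp ((fun (t : ℝ) (x : EuclideanSpace ℝ (Fin 3)) => if t < 1 then
          (A * (1 - t)⁻¹ * expNegInvGlue (4 - ‖x‖ ^ 2 / (1 - t))) •
            (WithLp.toLp 2 ![-(x 1), x 0, 0] : EuclideanSpace ℝ (Fin 3)) else 0) t) 2 MeasureTheory.volume ∧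
        ∫ x, ‖(fun (t : ℝ) (x : EuclideanSpace ℝ (Fin 3)) => if t < 1 then
          (A * (1 - t)⁻¹ * expNegInvGlue (4 - ‖x‖ ^ 2 / (1 - t))) •
            (WithLp.toLp 2 ![-(x 1), x 0, 0] : EuclideanSpace ℝ (Fin 3)) else 0) t x‖ ^ 2 ≤ E₀) ∧
      (0 < A → ∀ ρ : ℝ, 0 < ρ → ∀ M : ℝ, ∃ t ∈ Set.Ioo (1 - ρ ^ 2) 1,
        ∃ x ∈ Metric.ball (0 : EuclideanSpace ℝ (Fin 3)) ρ,
        M < ‖(fun (t : ℝ) (x : EuclideanSpace ℝ (Fin 3)) => if t < 1 then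
          (A * (1 - t)⁻¹ * expNegInvGlue (4 - ‖x‖ ^ 2 / (1 - t))) •
            (WithLp.toLp 2 ![-(x 1), x 0, 0] : EuclideanSpace ℝ (Fin 3)) else 0) t x‖) :=
  Summit.NavierStokesRegularity.NavierStokesRegularity.Theorems.stub_selfSimilarSwirl_pointwise

/-- **SSW2 — the load of the self-similar swirling eddy is bounded below by `κ A³` at every scale** (exact
self-similarity: `C(r)` does not depend on `r`). On the window `1 − t ∈ (r²/5, r²/4)` and the ball
`B((3r/5) e₀, r/20)` the speed is `≥ (22/(5e)) A / r`; `kinWitness_cknC_lowerBound_of_le_norm`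
(`…KinWitnessLoadLowerBound`) turns the product sub-region into the bound. -/
theorem stub_selfSimilarSwirl_loadFloor :
    ∃ κ : ℝ, 0 < κ ∧ ∀ A : ℝ, 0 ≤ A → ∀ r : ℝ, 0 < r →
      ENNReal.ofReal (κ * A ^ 3) ≤
        cknC r (((1 : ℝ), (0 : EuclideanSpace ℝ (Fin 3))) : ℝ × EuclideanSpace ℝ (Fin 3))
          (fun (t : ℝ) (x : EuclideanSpace ℝ (Fin 3)) => if t < 1 then
            (A * (1 - t)⁻¹ * expNegInvGlue (4 - ‖x‖ ^ 2 / (1 - t))) •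
              (WithLp.toLp 2 ![-(x 1), x 0, 0] : EuclideanSpace ℝ (Fin 3)) else 0) :=
  Summit.NavierStokesRegularity.NavierStokesRegularity.Theorems.stub_selfSimilarSwirl_loadFloor

/-- **SSW3 — the load of the self-similar swirling eddy is bounded above** (a Type-I CEILING in `C`): for
`t < 1` the slice is bounded by `2A (1−t)^{−1/2}` and supported in `B(0, 2√(1−t))`, so
`∫_{B_r} ‖uA t‖³ ≤ 64 A³ |B₁|` for every `t < 1` and `C(r) = r⁻² ∫∫_{Q_r(1,0)} ‖uA‖³ ≤ 64 A³ |B₁|` (Tonelli on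
the cylinder `(1 − r², 1) × B(0, r)`, `Measure.addHaar_ball`). -/
theorem stub_selfSimilarSwirl_loadCeiling :
    ∀ A : ℝ, 0 ≤ A → ∃ M₁ : ℝ, ∀ r : ℝ, 0 < r →
      cknC r (((1 : ℝ), (0 : EuclideanSpace ℝ (Fin 3))) : ℝ × EuclideanSpace ℝ (Fin 3))
          (fun (t : ℝ) (x : EuclideanSpace ℝ (Fin 3)) => if t < 1 then
            (A * (1 - t)⁻¹ * expNegInvGlue (4 - ‖x‖ ^ 2 / (1 - t))) •
              (WithLp.toLp 2 ![-(x 1), x 0, 0] : EuclideanSpace ℝ (Fin 3)) else 0) ≤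
        ENNReal.ofReal M₁ :=
  Summit.NavierStokesRegularity.NavierStokesRegularity.Theorems.stub_selfSimilarSwirl_loadCeiling

/-- **SW0 — sphere-tangential drifts are coherent at every scale (lead c3 assembly of SW1–SW4 + HF; registered
sub-goal).** There is a universal `δ₁ > 0` such that for every drift `u` that is TANGENTIAL TO THE SPHERES about the
origin on the window (`⟪u(t,x), x⟫ = 0`; no size, regularity or time-dependence assumption: every pure swirl /
spherical-shell flow `u = a(t,x) • (−x₁, x₀, 0)`, every differential rotation), every `T`, every scale `r > 0` and
every `0 ≤ δ ≤ δ₁`: `¬ DissipatesAtScale u T 0 r δ`. Radial blobs are exact first integrals of `u·∇` (the CKRZ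
non-relaxation-enhancing mechanism): the admissible heat evolution of a radial bump is radial (uniqueness + isometry
invariance), so its transport term vanishes and it is MIX-admissible for `u` while keeping the heat floor. -/
theorem stub_sphereTangential_notDissipatesAtScale :
    ∃ δ₁ : ℝ, 0 < δ₁ ∧
      ∀ (u : ℝ → EuclideanSpace ℝ (Fin 3) → EuclideanSpace ℝ (Fin 3)) (T r : ℝ), 0 < r →
      (∀ t ∈ Set.Icc (T - r ^ 2) (T - r ^ 2 / 2), ∀ x : EuclideanSpace ℝ (Fin 3),
        inner ℝ (u t x) x = 0) →
      ∀ δ : ℝ, 0 ≤ δ → δ ≤ δ₁ → ¬ DissipatesAtScale u T 0 r δ :=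
  Summit.NavierStokesRegularity.NavierStokesRegularity.Theorems.stub_sphereTangential_notDissipatesAtScale

/-- **Stub A is false without the momentum equation (lead c3 assembly of SW0 + SSW1–SSW3; registered sub-goal).**
The statement of the registered stub `stub_coherentTypeIExclusion` with its Navier–Stokes class hypotheses replaced by
the KINEMATIC class — smooth space–time field on `[0,T) × ℝ³`, divergence free, uniformly bounded finite energy, and an
`L∞` Type-I bound `√(T−t)‖u‖ ≤ K` for some `K` — is FALSE: for `δ` below the swirl-coherence constant and ANY
threshold `M`, the self-similar swirling eddy of amplitude `A = max 1 (M/κ)` has a Type-I ceiling in `C`, load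
`≥ M` and `¬ MIX(r, δ)` at EVERY scale, and is unbounded near `(1, 0)`. So regime A, like regime B
(`stub_coherentCascadeExclusion_false_without_momentum`, p165625), needs the momentum equation; unlike B its
Navier–Stokes form is implied by the named open statements S1 / `¬ TypeISingularityExists`. -/
theorem stub_coherentTypeIExclusion_false_without_momentum :
    ¬ (∀ δ : ℝ, 0 < δ → δ < 1 → ∃ M : ℝ, ∀ T : ℝ, 0 < T →
      ∀ (u : ℝ → EuclideanSpace ℝ (Fin 3) → EuclideanSpace ℝ (Fin 3)),
      Literature.Analysis.FluidPDE.IsSmoothSpaceTimeOn (Set.Ico 0 T) u →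
      (∀ t ∈ Set.Ico 0 T, Literature.Analysis.FluidPDE.VectorCalculus.IsDivFree (u t)) →
      (∃ E₀ : ℝ, ∀ t ∈ Set.Ico 0 T,
        MeasureTheory.MemLp (u t) 2 MeasureTheory.volume ∧ ∫ x, ‖u t x‖ ^ 2 ≤ E₀) →
      (∃ K : ℝ, ∀ t ∈ Set.Ico 0 T, ∀ x : EuclideanSpace ℝ (Fin 3), Real.sqrt (T - t) * ‖u t x‖ ≤ K) →
      ∀ x₀ : EuclideanSpace ℝ (Fin 3),
      (∃ M₁ r₁ : ℝ, 0 < r₁ ∧ ∀ r ∈ Set.Ioo 0 r₁,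
          Literature.Analysis.FluidPDE.cknC r ((T, x₀) : ℝ × EuclideanSpace ℝ (Fin 3)) u ≤
            ENNReal.ofReal M₁) →
      (∀ r₀ : ℝ, 0 < r₀ → ∃ r ∈ Set.Ioo 0 r₀,
          ENNReal.ofReal M ≤
            Literature.Analysis.FluidPDE.cknC r ((T, x₀) : ℝ × EuclideanSpace ℝ (Fin 3)) u ∧
          ¬ Literature.Analysis.FluidPDE.DissipatesAtScale u T x₀ r δ) →
      ∃ ρ : ℝ, 0 < ρ ∧ ∃ M' : ℝ, ∀ t ∈ Set.Ioo (T - ρ ^ 2) T, ∀ x ∈ Metric.ball x₀ ρ,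
        ‖u t x‖ ≤ M') :=
  Summit.NavierStokesRegularity.NavierStokesRegularity.Theorems.stub_coherentTypeIExclusion_false_without_momentum

/-! ## Lead c3, wave 2: invariances and robustness of the MIX functional (registered sub-goals) -/

/-- **INV1 — translation invariance of `DissipatesAtScale`.** The scalar dissipation factor of `u` at `(T, x₀)` equals
that of the translated drift `(t, y) ↦ u t (y + x₀)` at `(T, 0)`: admissible scalars correspond under
`θ ↦ θ(t, · + x₀)` (joint smoothness, uniform rapid decay with shifted polynomial weights
`1 + ‖y + x₀‖ ≤ (1 + ‖x₀‖)(1 + ‖y‖)`, `iteratedFDerivWithin_comp_add_right`; `timeDerivWithin` is pointwise in `x`;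
`gradient`/`Δ` commute with translations; supports and whole-space integrals are translation invariant). -/
theorem stub_dissipatesAtScale_translate :
    ∀ (u : ℝ → EuclideanSpace ℝ (Fin 3) → EuclideanSpace ℝ (Fin 3)) (T : ℝ) (x₀ : EuclideanSpace ℝ (Fin 3))
      (r δ : ℝ),
      DissipatesAtScale u T x₀ r δ ↔ DissipatesAtScale (fun t y => u t (y + x₀)) T 0 r δ :=
  Summit.NavierStokesRegularity.NavierStokesRegularity.Theorems.stub_dissipatesAtScale_translate

/-- **INV2 — isometry covariance of `DissipatesAtScale`.** For a linear isometry `R` of `ℝ³`, the conjugated drift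
`(t, y) ↦ R (u t (R⁻¹ y))` dissipates at scale `r` with factor `δ` at `(T, R x₀)` iff `u` does at `(T, x₀)`:
admissible scalars correspond under `θ ↦ θ(t, R⁻¹ ·)` (`Literature/Analysis/FluidPDE/IsometryInvariance`:
`IsSmoothSpaceTimeOn.comp_linearIsometryEquiv_symm`, `gradient_comp_linearIsometryEquiv_symm`,
`laplacian_comp_linearIsometryEquiv_symm`; scalar decay transfer `HeatIsometry.hasUniformRapidDecayOn_comp_linearIsometryEquiv_symm`;
`⟪R v, R w⟫ = ⟪v, w⟫`; `R` preserves Lebesgue measure and maps `ball x₀ r` onto `ball (R x₀) r`). -/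
theorem stub_dissipatesAtScale_isometry :
    ∀ (R : EuclideanSpace ℝ (Fin 3) ≃ₗᵢ[ℝ] EuclideanSpace ℝ (Fin 3))
      (u : ℝ → EuclideanSpace ℝ (Fin 3) → EuclideanSpace ℝ (Fin 3)) (T : ℝ) (x₀ : EuclideanSpace ℝ (Fin 3))
      (r δ : ℝ),
      DissipatesAtScale (fun t y => R (u t (R.symm y))) T (R x₀) r δ ↔ DissipatesAtScale u T x₀ r δ :=
  Summit.NavierStokesRegularity.NavierStokesRegularity.Theorems.stub_dissipatesAtScale_isometry

/-- **STAB — stability of admissible passive scalars in the drift (whole-space, MIX-class form of Johansson–Sorella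
2024, Lemma 2.2).** Two jointly smooth, uniformly rapidly decaying solutions `θ₁, θ₂` of `∂ₜθᵢ + ⟪uᵢ, ∇θᵢ⟫ = Δθᵢ` on
`[a, b] × ℝ³` from the same datum, in drifts whose slices are `C¹`, divergence free and square integrable, satisfy
`∫ (θ₁(t) − θ₂(t))² ≤ M² V (t − a)` whenever `|θ₂| ≤ M` on the slab and `∫ ‖u₁(s) − u₂(s)‖² ≤ V` at every time of
the slab. Energy method for `w = θ₁ − θ₂`: `(∫w²)' = −2∫‖∇w‖² + 2∫ θ₂ ⟪u₁ − u₂, ∇w⟫` (the transport term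
`∫ w⟪u₁,∇w⟫` vanishes, the cross term `−∫ w ⟪u₁−u₂, ∇θ₂⟫` is moved onto `w` by polarising
`integral_mul_inner_gradient_eq_zero_of_memLp`), Cauchy–Schwarz and Young `2M‖δu‖‖∇w‖ ≤ ‖∇w‖² + M²‖δu‖²`. -/
theorem stub_mixClass_driftStability :
    ∀ (a b : ℝ), a < b →
      ∀ (u₁ u₂ : ℝ → EuclideanSpace ℝ (Fin 3) → EuclideanSpace ℝ (Fin 3))
        (θ₁ θ₂ : ℝ → EuclideanSpace ℝ (Fin 3) → ℝ),
      IsSmoothSpaceTimeOn (Set.Icc a b) θ₁ → HasUniformRapidDecayOn (Set.Icc a b) θ₁ →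
      (∀ t ∈ Set.Icc a b, ∀ x : EuclideanSpace ℝ (Fin 3),
        timeDerivWithin (Set.Icc a b) θ₁ t x + inner ℝ (u₁ t x) (gradient (θ₁ t) x) =
          Laplacian.laplacian (θ₁ t) x) →
      IsSmoothSpaceTimeOn (Set.Icc a b) θ₂ → HasUniformRapidDecayOn (Set.Icc a b) θ₂ →
      (∀ t ∈ Set.Icc a b, ∀ x : EuclideanSpace ℝ (Fin 3),
        timeDerivWithin (Set.Icc a b) θ₂ t x + inner ℝ (u₂ t x) (gradient (θ₂ t) x) =
          Laplacian.laplacian (θ₂ t) x) →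
      (∀ t ∈ Set.Icc a b, ContDiff ℝ 1 (u₁ t)) →
      (∀ t ∈ Set.Icc a b, Literature.Analysis.FluidPDE.VectorCalculus.IsDivFree (u₁ t)) →
      (∀ t ∈ Set.Icc a b, MeasureTheory.MemLp (u₁ t) 2 MeasureTheory.volume) →
      (∀ t ∈ Set.Icc a b, ContDiff ℝ 1 (u₂ t)) →
      (∀ t ∈ Set.Icc a b, Literature.Analysis.FluidPDE.VectorCalculus.IsDivFree (u₂ t)) →
      (∀ t ∈ Set.Icc a b, MeasureTheory.MemLp (u₂ t) 2 MeasureTheory.volume) →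
      θ₁ a = θ₂ a →
      ∀ (M V : ℝ), (∀ t ∈ Set.Icc a b, ∀ x : EuclideanSpace ℝ (Fin 3), |θ₂ t x| ≤ M) →
      (∀ t ∈ Set.Icc a b, ∫ x, ‖u₁ t x - u₂ t x‖ ^ 2 ≤ V) →
      ∀ t ∈ Set.Icc a b, ∫ x, (θ₁ t x - θ₂ t x) ^ 2 ≤ M ^ 2 * V * (t - a) :=
  Summit.NavierStokesRegularity.NavierStokesRegularity.Theorems.stub_mixClass_driftStability

/-- **MAXP — two-sided maximum principle for admissible passive scalars in a bounded drift.** A jointly smooth,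
uniformly rapidly decaying solution of `∂ₜθ + ⟪u, ∇θ⟫ = Δθ` on `[a, b] × ℝ³` with `‖u‖ ≤ B` on the slab and
`|θ(a)| ≤ M₀` satisfies `|θ| ≤ M₀` on the slab (the tree's bounded-class weak maximum principle
`nonpos_of_linear_parabolic` applied to `θ − M₀` and `−θ − M₀`, `β = −u`, `γ = 0`). -/
theorem stub_mixClass_abs_le_of_datum :
    ∀ (a b : ℝ), a < b →
      ∀ (u : ℝ → EuclideanSpace ℝ (Fin 3) → EuclideanSpace ℝ (Fin 3)) (θ : ℝ → EuclideanSpace ℝ (Fin 3) → ℝ)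
        (B M₀ : ℝ),
      IsSmoothSpaceTimeOn (Set.Icc a b) θ → HasUniformRapidDecayOn (Set.Icc a b) θ →
      (∀ t ∈ Set.Icc a b, ∀ x : EuclideanSpace ℝ (Fin 3),
        timeDerivWithin (Set.Icc a b) θ t x + inner ℝ (u t x) (gradient (θ t) x) =
          Laplacian.laplacian (θ t) x) →
      (∀ t ∈ Set.Icc a b, ∀ x : EuclideanSpace ℝ (Fin 3), ‖u t x‖ ≤ B) →
      (∀ x : EuclideanSpace ℝ (Fin 3), |θ a x| ≤ M₀) →
      ∀ t ∈ Set.Icc a b, ∀ x : EuclideanSpace ℝ (Fin 3), |θ t x| ≤ M₀ :=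
  Summit.NavierStokesRegularity.NavierStokesRegularity.Theorems.stub_mixClass_abs_le_of_datum

/-- **INV3 — Galilean-boost invariance of `DissipatesAtScale`.** The route text's "MIX is Galilean invariant": for a
constant velocity `c`, the drift seen in the frame moving with velocity `c` from the initial time `a = T − r²` of the
window, `(t, y) ↦ u t (y + (t − a) • c) − c`, dissipates at scale `r` with factor `δ` at `(T, x₀)` iff `u` does:
admissible scalars correspond under `θ ↦ θ(t, · + (t − a) • c)` (the datum at `t = a` and its support are unchanged,
whole-space `L²` norms are translation invariant, `∂ₜ[θ(t, y + (t−a)c)] = ∂ₜθ + Dθ[c]` absorbs the `−c`; uniform rapid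
decay transfers through the affine change of variables `(t, y) ↦ (t, y + (t − a)c)` of the slab). -/
theorem stub_dissipatesAtScale_galilean :
    ∀ (u : ℝ → EuclideanSpace ℝ (Fin 3) → EuclideanSpace ℝ (Fin 3)) (T : ℝ) (x₀ c : EuclideanSpace ℝ (Fin 3))
      (r δ : ℝ),
      DissipatesAtScale u T x₀ r δ ↔
        DissipatesAtScale (fun t y => u t (y + (t - (T - r ^ 2)) • c) - c) T x₀ r δ :=
  Summit.NavierStokesRegularity.NavierStokesRegularity.Theorems.stub_dissipatesAtScale_galilean

/-- **TAIL — Gaussian upper bound for the heat evolution of a sub-unit blob.** An admissible heat solution `θ` on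
`[a, b] × ℝ³` whose datum satisfies `θ(a) ≤ 1` and is supported in `B(0, r)` lies below the exact Gaussian solution
`g(t, x) = e^{1/4} (r²/s)^{3/2} e^{−‖x‖²/(4s)}`, `s = t − a + r²` (which dominates the datum: `g(a, ·) ≥ 1` on `B_r`),
hence `θ(t, x) ≤ e^{1/4} e^{−‖x‖²/(4 (t − a + r²))}` — by the bounded-class weak maximum principle for `θ − g`
(`mixMaxPrinciple_le_of_datum_le` / `nonpos_of_linear_parabolic`, zero drift; the tree's `laplacian_heatKernel`,
`hasDerivAt_heatKernel_time` give the heat equation for `g`). On the window `b − a = r²/2` this is the scale-free tail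
`θ ≤ e^{1/4 − ‖x‖²/(6 r²)}`. -/
theorem stub_heatBlob_gaussian_upper :
    ∀ (a b : ℝ), a < b → ∀ (θ : ℝ → EuclideanSpace ℝ (Fin 3) → ℝ) (r : ℝ), 0 < r →
      IsSmoothSpaceTimeOn (Set.Icc a b) θ → HasUniformRapidDecayOn (Set.Icc a b) θ →
      (∀ t ∈ Set.Icc a b, ∀ x : EuclideanSpace ℝ (Fin 3),
        timeDerivWithin (Set.Icc a b) θ t x = Laplacian.laplacian (θ t) x) →
      (∀ x : EuclideanSpace ℝ (Fin 3), θ a x ≤ 1) →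
      Function.support (θ a) ⊆ Metric.ball (0 : EuclideanSpace ℝ (Fin 3)) r →
      ∀ t ∈ Set.Icc a b, ∀ x : EuclideanSpace ℝ (Fin 3),
        θ t x ≤ Real.exp (1 / 4) * Real.exp (-‖x‖ ^ 2 / (4 * (t - a + r ^ 2))) :=
  Summit.NavierStokesRegularity.NavierStokesRegularity.Theorems.stub_heatBlob_gaussian_upper

/-- **STAB-loc — LOCALISED drift stability** (registered sub-goal): as `stub_mixClass_driftStability`, but the cross
term is split over a measurable set `D` and its complement: with `|θ₂| ≤ Mi` on `D`, `≤ Mo` on `Dᶜ`, and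
`∫_D ‖u₁ − u₂‖² ≤ Vi`, `∫_{Dᶜ} ‖u₁ − u₂‖² ≤ Vo` at every time, `∫ (θ₁ − θ₂)(t)² ≤ (Mi² Vi + Mo² Vo)(t − a)`
(Cauchy–Schwarz on each piece and Young `2αβ ≤ β² + α²` twice against the `2∫‖∇w‖²`). -/
theorem stub_mixClass_driftStability_local :
    ∀ (a b : ℝ), a < b →
      ∀ (u₁ u₂ : ℝ → EuclideanSpace ℝ (Fin 3) → EuclideanSpace ℝ (Fin 3))
        (θ₁ θ₂ : ℝ → EuclideanSpace ℝ (Fin 3) → ℝ) (D : Set (EuclideanSpace ℝ (Fin 3))), MeasurableSet D →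
      IsSmoothSpaceTimeOn (Set.Icc a b) θ₁ → HasUniformRapidDecayOn (Set.Icc a b) θ₁ →
      (∀ t ∈ Set.Icc a b, ∀ x : EuclideanSpace ℝ (Fin 3),
        timeDerivWithin (Set.Icc a b) θ₁ t x + inner ℝ (u₁ t x) (gradient (θ₁ t) x) =
          Laplacian.laplacian (θ₁ t) x) →
      IsSmoothSpaceTimeOn (Set.Icc a b) θ₂ → HasUniformRapidDecayOn (Set.Icc a b) θ₂ →
      (∀ t ∈ Set.Icc a b, ∀ x : EuclideanSpace ℝ (Fin 3),
        timeDerivWithin (Set.Icc a b) θ₂ t x + inner ℝ (u₂ t x) (gradient (θ₂ t) x) =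
          Laplacian.laplacian (θ₂ t) x) →
      (∀ t ∈ Set.Icc a b, ContDiff ℝ 1 (u₁ t)) →
      (∀ t ∈ Set.Icc a b, Literature.Analysis.FluidPDE.VectorCalculus.IsDivFree (u₁ t)) →
      (∀ t ∈ Set.Icc a b, MeasureTheory.MemLp (u₁ t) 2 MeasureTheory.volume) →
      (∀ t ∈ Set.Icc a b, ContDiff ℝ 1 (u₂ t)) →
      (∀ t ∈ Set.Icc a b, Literature.Analysis.FluidPDE.VectorCalculus.IsDivFree (u₂ t)) →
      (∀ t ∈ Set.Icc a b, MeasureTheory.MemLp (u₂ t) 2 MeasureTheory.volume) →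
      θ₁ a = θ₂ a →
      ∀ (Mi Mo Vi Vo : ℝ), 0 ≤ Mi → 0 ≤ Mo →
      (∀ t ∈ Set.Icc a b, ∀ x ∈ D, |θ₂ t x| ≤ Mi) →
      (∀ t ∈ Set.Icc a b, ∀ x ∈ Dᶜ, |θ₂ t x| ≤ Mo) →
      (∀ t ∈ Set.Icc a b, ∫ x in D, ‖u₁ t x - u₂ t x‖ ^ 2 ≤ Vi) →
      (∀ t ∈ Set.Icc a b, ∫ x in Dᶜ, ‖u₁ t x - u₂ t x‖ ^ 2 ≤ Vo) →
      ∀ t ∈ Set.Icc a b, ∫ x, (θ₁ t x - θ₂ t x) ^ 2 ≤ (Mi ^ 2 * Vi + Mo ^ 2 * Vo) * (t - a) :=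
  Summit.NavierStokesRegularity.NavierStokesRegularity.Theorems.stub_mixClass_driftStability_local

/-- **ROBUST-loc — localised robust swirl coherence for finite-energy drifts** (lead glue of SW0 + STAB-loc + MAXP +
TAIL + HF; registered sub-goal). Universal `δ₂, c₀ > 0`: if `v` is sphere-tangential about `0` (C¹ div-free L² slices)
and `u` (well-posedness class, div-free L² slices) is `L²`-close to `v` ONLY ON THE BALL `B(0, R r)`,
`∫_{B(0,Rr)} ‖u − v‖² ≤ c₀ r`, with an arbitrary bound `E` outside (`∫_{B(0,Rr)ᶜ} ‖u − v‖² ≤ E`, e.g. four times the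
energies) and the radius chosen so large that the Gaussian tail of the heat blob absorbs it, `e^{1/2 − R²/3} E ≤ c₀ r`
(`R ≍ √(3 log(E/(c₀ r)))`: logarithmic in the scale), then `¬ DissipatesAtScale u T 0 r δ` for `0 ≤ δ ≤ δ₂`. This is
the form applicable to Navier–Stokes velocities, which are never globally close to a toroidal field. -/
theorem stub_notDissipatesAtScale_of_locallyNear_sphereTangential :
    ∃ δ₂ c₀ : ℝ, 0 < δ₂ ∧ 0 < c₀ ∧
      ∀ (u v : ℝ → EuclideanSpace ℝ (Fin 3) → EuclideanSpace ℝ (Fin 3)) (T r R E : ℝ), 0 < r → 1 ≤ R →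
      (∀ t ∈ Set.Icc (T - r ^ 2) (T - r ^ 2 / 2), ∀ x : EuclideanSpace ℝ (Fin 3), inner ℝ (v t x) x = 0) →
      (∀ t ∈ Set.Icc (T - r ^ 2) (T - r ^ 2 / 2), ContDiff ℝ 1 (v t)) →
      (∀ t ∈ Set.Icc (T - r ^ 2) (T - r ^ 2 / 2), Literature.Analysis.FluidPDE.VectorCalculus.IsDivFree (v t)) →
      (∀ t ∈ Set.Icc (T - r ^ 2) (T - r ^ 2 / 2), MeasureTheory.MemLp (v t) 2 MeasureTheory.volume) →
      IsSmoothSpaceTimeOn (Set.Icc (T - r ^ 2) (T - r ^ 2 / 2)) u →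
      (∀ n : ℕ, ∃ C : ℝ, ∀ t ∈ Set.Icc (T - r ^ 2) (T - r ^ 2 / 2), ∀ x : EuclideanSpace ℝ (Fin 3),
        ‖iteratedFDerivWithin ℝ n (Function.uncurry u)
          (Set.Icc (T - r ^ 2) (T - r ^ 2 / 2) ×ˢ Set.univ) (t, x)‖ ≤ C) →
      (∀ t ∈ Set.Icc (T - r ^ 2) (T - r ^ 2 / 2), Literature.Analysis.FluidPDE.VectorCalculus.IsDivFree (u t)) →
      (∀ t ∈ Set.Icc (T - r ^ 2) (T - r ^ 2 / 2), MeasureTheory.MemLp (u t) 2 MeasureTheory.volume) →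
      (∀ t ∈ Set.Icc (T - r ^ 2) (T - r ^ 2 / 2),
        ∫ x in Metric.ball (0 : EuclideanSpace ℝ (Fin 3)) (R * r), ‖u t x - v t x‖ ^ 2 ≤ c₀ * r) →
      (∀ t ∈ Set.Icc (T - r ^ 2) (T - r ^ 2 / 2),
        ∫ x in (Metric.ball (0 : EuclideanSpace ℝ (Fin 3)) (R * r))ᶜ, ‖u t x - v t x‖ ^ 2 ≤ E) →
      Real.exp (1 / 2 - R ^ 2 / 3) * E ≤ c₀ * r →
      ∀ δ : ℝ, 0 ≤ δ → δ ≤ δ₂ → ¬ DissipatesAtScale u T 0 r δ :=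
  Summit.NavierStokesRegularity.NavierStokesRegularity.Theorems.stub_notDissipatesAtScale_of_locallyNear_sphereTangential

/-- **SW0 at a general centre (lead c3 wave-2 glue of SW0 + INV1; registered sub-goal).** For drifts tangential to the
spheres about `x₀` on the window (`⟪u(t,x), x − x₀⟫ = 0`), `¬ DissipatesAtScale u T x₀ r δ` for every `r > 0` and every
`0 ≤ δ ≤ δ₁` (`δ₁` universal, the constant of `stub_sphereTangential_notDissipatesAtScale`). -/
theorem stub_sphereTangential_notDissipatesAtScale_centre :
    ∃ δ₁ : ℝ, 0 < δ₁ ∧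
      ∀ (u : ℝ → EuclideanSpace ℝ (Fin 3) → EuclideanSpace ℝ (Fin 3)) (T : ℝ) (x₀ : EuclideanSpace ℝ (Fin 3))
        (r : ℝ), 0 < r →
      (∀ t ∈ Set.Icc (T - r ^ 2) (T - r ^ 2 / 2), ∀ x : EuclideanSpace ℝ (Fin 3),
        inner ℝ (u t x) (x - x₀) = 0) →
      ∀ δ : ℝ, 0 ≤ δ → δ ≤ δ₁ → ¬ DissipatesAtScale u T x₀ r δ :=
  Summit.NavierStokesRegularity.NavierStokesRegularity.Theorems.stub_sphereTangential_notDissipatesAtScale_centre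

/-- **ROBUST swirl coherence (lead c3 wave-2 glue of SW0 + STAB + MAXP + HF; registered sub-goal).** There are
universal `δ₂, c₀ > 0` such that: if `v` is a sphere-tangential drift about `0` on the window with `C¹`, divergence-free,
square-integrable slices, and `u` is any drift that is jointly smooth with bounded derivatives on the window slab, with
divergence-free square-integrable slices, and `L²`-CLOSE to `v` at the scale-invariant rate
`∫ ‖u(t) − v(t)‖² ≤ c₀ r` at every time of the window, then `¬ DissipatesAtScale u T 0 r δ` for every `0 ≤ δ ≤ δ₂`.
Non-mixing is an OPEN condition around the coherent class: the `u`-evolution of the radial bump stays within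
`√(c₀ r · r²/2)` of its heat evolution in `L²` (drift stability with `|θ_heat| ≤ 1`), which keeps the heat floor. -/
theorem stub_notDissipatesAtScale_of_near_sphereTangential :
    ∃ δ₂ c₀ : ℝ, 0 < δ₂ ∧ 0 < c₀ ∧
      ∀ (u v : ℝ → EuclideanSpace ℝ (Fin 3) → EuclideanSpace ℝ (Fin 3)) (T r : ℝ), 0 < r →
      (∀ t ∈ Set.Icc (T - r ^ 2) (T - r ^ 2 / 2), ∀ x : EuclideanSpace ℝ (Fin 3), inner ℝ (v t x) x = 0) →
      (∀ t ∈ Set.Icc (T - r ^ 2) (T - r ^ 2 / 2), ContDiff ℝ 1 (v t)) →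
      (∀ t ∈ Set.Icc (T - r ^ 2) (T - r ^ 2 / 2), Literature.Analysis.FluidPDE.VectorCalculus.IsDivFree (v t)) →
      (∀ t ∈ Set.Icc (T - r ^ 2) (T - r ^ 2 / 2), MeasureTheory.MemLp (v t) 2 MeasureTheory.volume) →
      IsSmoothSpaceTimeOn (Set.Icc (T - r ^ 2) (T - r ^ 2 / 2)) u →
      (∀ n : ℕ, ∃ C : ℝ, ∀ t ∈ Set.Icc (T - r ^ 2) (T - r ^ 2 / 2), ∀ x : EuclideanSpace ℝ (Fin 3),
        ‖iteratedFDerivWithin ℝ n (Function.uncurry u)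
          (Set.Icc (T - r ^ 2) (T - r ^ 2 / 2) ×ˢ Set.univ) (t, x)‖ ≤ C) →
      (∀ t ∈ Set.Icc (T - r ^ 2) (T - r ^ 2 / 2), Literature.Analysis.FluidPDE.VectorCalculus.IsDivFree (u t)) →
      (∀ t ∈ Set.Icc (T - r ^ 2) (T - r ^ 2 / 2), MeasureTheory.MemLp (u t) 2 MeasureTheory.volume) →
      (∀ t ∈ Set.Icc (T - r ^ 2) (T - r ^ 2 / 2), ∫ x, ‖u t x - v t x‖ ^ 2 ≤ c₀ * r) →
      ∀ δ : ℝ, 0 ≤ δ → δ ≤ δ₂ → ¬ DissipatesAtScale u T 0 r δ :=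
  Summit.NavierStokesRegularity.NavierStokesRegularity.Theorems.stub_notDissipatesAtScale_of_near_sphereTangential

/-- **The Nash ceiling for standing Navier–Stokes velocities (glue of K, N, C; lead reshape r2).** There is a
drift-independent `δ₀ ∈ (0,1)` such that for every `δ ≥ δ₀`, every classical solution `(u, p)` of Navier–Stokes
(`ν = 1`) on `ℝ³ × [0,T)` whose velocity is Leray–Hopf on `[0,T]`, every `x₀` and every scale `0 < r`, `r² ≤ T`,
the drift `δ`-mixes at scale `r`: `DissipatesAtScale u T x₀ r δ`. On the window `[T − r², T − r²/2] ⊆ [0, T)` the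
slices `u t` are smooth, divergence free and square integrable (as in
`IsClassicalNSSolutionOn.dissipatesAtScale_of_isLerayHopfOn`). -/
theorem nashCeiling :
    ∃ δ₀ : ℝ, 0 < δ₀ ∧ δ₀ < 1 ∧ ∀ δ : ℝ, δ₀ ≤ δ → ∀ T : ℝ, 0 < T →
      ∀ (u : ℝ → EuclideanSpace ℝ (Fin 3) → EuclideanSpace ℝ (Fin 3)) (p : ℝ → EuclideanSpace ℝ (Fin 3) → ℝ),
      IsClassicalNSSolutionOn (Set.Ico 0 T) 1 0 u p → IsLerayHopfOn T 1 0 (u 0) u →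
      ∀ (x₀ : EuclideanSpace ℝ (Fin 3)) (r : ℝ), 0 < r → r ^ 2 ≤ T → DissipatesAtScale u T x₀ r δ := by
  obtain ⟨δ₀, hδ₀, hδ₀1, hceil⟩ := stub_nashCeilingAssembly stub_passiveScalarL1Antitone stub_nashInequality
  refine ⟨δ₀, hδ₀, hδ₀1, fun δ hδ T _hT u p hcl hLH x₀ r hr hrT => ?_⟩
  have hwin : ∀ t ∈ Set.Icc (T - r ^ 2) (T - r ^ 2 / 2), t ∈ Set.Ico 0 T ∧ t ∈ Set.Icc 0 T := by
    intro t ht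
    have hr2 : 0 < r ^ 2 := by positivity
    exact ⟨⟨by linarith [ht.1], by linarith [ht.2]⟩, ⟨by linarith [ht.1], by linarith [ht.2]⟩⟩
  exact hceil δ hδ u T x₀ r hr (fun t ht => contDiff_infty.1 (hcl.contDiff_velocity (hwin t ht).1) 1)
    (fun t ht => hcl.divFree t (hwin t ht).1) (fun t ht => hLH.memLp t (hwin t ht).2)

/-- **Composition (the skeleton theorem; birth cut, lead reshapes r1–r2).** The crux BY NAME from the registered
stubs, used by name. Case `δ ≥ δ₀` (the Nash ceiling `nashCeiling` ← stubs K, N, C; `δ₀ < 1` drift independent):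
EMPTY regime — every scale `r ≤ √T` is `δ`-mixing, so non-`δ`-mixing scales do not recur and any threshold works.
Case `0 < δ < δ₀ (< 1)`: `M := max M_A M_I`; recurrence is antitone in the threshold; the load profile at the
point is, by two uses of excluded middle, a pure cascade (stub B), or has a ceiling (stub A), or has windows and
unbounded load (stub I). The same proof with the stub STATEMENTS as hypotheses — a closed theorem — is the tree
theorem `coherentScaleExclusion_of_regimes` (Theorems/SelfMixingDichotomyCoherentScaleExclusionStructure). -/
theorem CoherentScaleExclusion_of : Theses.SelfMixingDichotomy.CoherentScaleExclusion := by
  have hA := stub_coherentTypeIExclusion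
  have hI := stub_coherentWindowExclusion
  have hB := stub_coherentCascadeExclusion
  obtain ⟨δ₀, _hδ₀, hδ₀1, hceil⟩ := nashCeiling
  intro δ hδ
  -- the regime `δ ≥ δ₀` is EMPTY (Nash ceiling): every scale `r` with `r² ≤ T` is `δ`-mixing, so
  -- non-`δ`-mixing scales do not recur below `√T` and the antecedent of the crux fails; any threshold works.
  rcases le_or_gt δ₀ δ with hδ1 | hδ1
  · refine ⟨0, fun T hT u p hcl hLH _hdec x₀ hRec => ?_⟩
    exfalso
    obtain ⟨r, hr, -, hnot⟩ := hRec (Real.sqrt T) (Real.sqrt_pos.2 hT)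
    refine hnot (hceil δ hδ1 T hT u p hcl hLH x₀ r hr.1 ?_)
    have h1 : r ^ 2 < (Real.sqrt T) ^ 2 := by nlinarith [hr.1, hr.2]
    rw [Real.sq_sqrt hT.le] at h1
    exact h1.le
  -- the contentful range `0 < δ < δ₀ < 1`: regime decomposition of the load profile
  replace hδ1 : δ < 1 := hδ1.trans hδ₀1
  obtain ⟨MA, hMA⟩ := hA δ hδ hδ1
  obtain ⟨MI, hMI⟩ := hI δ hδ hδ1
  refine ⟨max MA MI, ?_⟩
  intro T hT u p hcl hLH hdec x₀ hRec
  -- regime (B): the load diverges along all small scales — the threshold is irrelevant, coherence alone recurs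
  by_cases hcasc : ∀ M' : ℝ, ∃ r₁ : ℝ, 0 < r₁ ∧ ∀ r ∈ Set.Ioo 0 r₁,
      ENNReal.ofReal M' ≤ cknC r ((T, x₀) : ℝ × EuclideanSpace ℝ (Fin 3)) u
  · exact (hB δ hδ hδ1 T hT u p hcl hLH hdec x₀ hcasc
      (fun r₀ hr₀ => (hRec r₀ hr₀).imp fun r hr => ⟨hr.1, hr.2.2⟩)).elim
  -- otherwise bounded-load scales recur: `liminf C < ∞`
  have hwin : ∃ M' : ℝ, ∀ r₁ : ℝ, 0 < r₁ → ∃ r ∈ Set.Ioo 0 r₁,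
      cknC r ((T, x₀) : ℝ × EuclideanSpace ℝ (Fin 3)) u ≤ ENNReal.ofReal M' := by
    push Not at hcasc
    obtain ⟨M', hM'⟩ := hcasc
    exact ⟨M', fun r₁ hr₁ => (hM' r₁ hr₁).imp fun r hr => ⟨hr.1, hr.2.le⟩⟩
  -- regime (A): a Type-I ceiling at the point
  by_cases hceil : ∃ M₁ r₁ : ℝ, 0 < r₁ ∧ ∀ r ∈ Set.Ioo 0 r₁,
      cknC r ((T, x₀) : ℝ × EuclideanSpace ℝ (Fin 3)) u ≤ ENNReal.ofReal M₁
  · exact hMA T hT u p hcl hLH hdec x₀ hceil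
      (fun r₀ hr₀ => (hRec r₀ hr₀).imp fun r hr =>
        ⟨hr.1, le_trans (ENNReal.ofReal_le_ofReal (le_max_left MA MI)) hr.2.1, hr.2.2⟩)
  -- regime (I): windows recur but the load is unbounded
  have hunb : ∀ M'' r₁ : ℝ, 0 < r₁ → ∃ r ∈ Set.Ioo 0 r₁,
      ENNReal.ofReal M'' < cknC r ((T, x₀) : ℝ × EuclideanSpace ℝ (Fin 3)) u := by
    push Not at hceil
    exact fun M'' r₁ hr₁ => hceil M'' r₁ hr₁
  exact (hMI T hT u p hcl hLH hdec x₀ hwin hunb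
    (fun r₀ hr₀ => (hRec r₀ hr₀).imp fun r hr =>
      ⟨hr.1, le_trans (ENNReal.ofReal_le_ofReal (le_max_right MA MI)) hr.2.1, hr.2.2⟩)).elim

end Summit.NavierStokesRegularity.NavierStokesRegularity.Cruxes.CoherentScaleExclusion.Birth
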